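import Literature.MathematicalPhysics.QuantumLattice.FermiRG.BGM2006Sec2TadpoleProof
import Literature.Analysis.Fourier.MatsubaraSummationByParts
import HarnessLib

/-!
# Benfatto–Giuliani–Mastropietro 2006, §2.4–§2.5: the support of the single-scale cutoff `f_h` at ALL
scales, the sector propagators at general `x`, and the dimensional bound (2.50)

Companion proof file of `BGM2006Sec2Setup.lean` (typer-wave file F1a of the cell `gate-hubbard-kl`;
source BGM06 = G. Benfatto, A. Giuliani, V. Mastropietro, *Fermi liquid behavior in the 2D Hubbard model
at low temperatures*, Ann. Henri Poincaré **7** (2006) 809–898, arXiv:cond-mat/0507686; locators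
`p00NN:Lnn` = chunk/line of the `lit read` render of the arXiv TeX).  This is the first third of the
proof of Lemmas 2.2 / 2.3 (the DECAY bounds (2.52)/(2.60), named facts `BGM2006_Lemma_2_2`,
`BGM2006_Lemma_2_3` of F1a): the printed proof (p0010:L129–p0011:L33) rests on "dimensional bounds on the
integrand and on the measure of the support" plus integration by parts; here the SUPPORT and the
DIMENSIONAL part are made honest at every scale `h_β ≤ h ≤ 0` and every point `x = (x₀, x⃗)`.

What is new relative to `BGM2006Sec2TadpoleProof.lean` (t1 g5, which treats `x = 0` and only needs the
scales below a `μ, e₀`-dependent threshold, the finitely many others being absorbed by a crude bound):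

* §1 the SHARP pointwise support statement (2.42a) read off (2.28): `f_h(k) ≠ 0` forces
  `|-ik₀ + E_h(k) - μ| < e₀γ^h` (not only `< 2e₀γ^h` for `E_{h-1}`), whence `|Re E_h(k) - μ| < e₀γ^h`
  and — with `|E_h - ε₀| ≤ 2C₀c₀` (2.42) — `|ε₀(k⃗) - μ| < e₀γ^h + 2C₀c₀`: for `c₀` small this puts the
  momentum support inside the annulus `-4 < μ - e₀ - 2C₀c₀ < ε₀ < μ + e₀ + 2C₀c₀ < -2-√2` at EVERY scale
  (BGM: `e₀ < μ₀ - μ'`, §2.4 item 1), hence inside the Euclidean disc `|k⃗| < π/4` of one period cell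
  and outside the disc `|k⃗|² ≤ μ + 4 - e₀ - 2C₀c₀` around the origin (where the polar angle is singular);
* §2 the period-cell bookkeeping (the shifted integrand `k⃗ = k⃗' + p⃗_F(θ_{h,ω})` of (2.49) sees exactly
  one translate) at all scales;
* §3 (2.49)/(2.59) at GENERAL `x`: `g(x₀,x⃗)` is the finite Matsubara sum
  `(1/β) Σ_j e^{-ik₀(j)x₀} S_j(x⃗)`, `S_j(x⃗) = ∫_{[-π,π]²} e^{-ik⃗'·x⃗} F_{h,ω}/D_{h-1} dk⃗'/(2π)²` — the
  shape on which the Matsubara summation by parts of `Analysis/Fourier/MatsubaraSummationByParts.lean`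
  acts;
* §4 the per-frequency RADIAL LOCALISATION with the real part `Re E_h(k₀, ·)` of the moving dispersion at
  the given Matsubara frequency as the level function (it is `C²` and `C¹`-close to `ε₀` by (2.36), so
  t1 g5's radial separation `mul_abs_sub_le_abs_eps_sub` applies): along each ray the support of
  `f_h(k₀, ·)` has length `≤ 2e₀γ^h/m`, `m = m(μ, e₀) > 0`;
* §5 **the dimensional bound (2.50) at every `x` and every scale**, uniformly in `β`:
  `|g^{(h)}_ω(x)| ≤ K γ^h · (sector width)`, i.e. `≤ Cγ^{3h/2}` for the anisotropic and `≤ Cγ^{2h}` for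
  the isotropic propagators (BGM p0011:L5–L6: "by the compact support properties of `F_{h,ω}(k)` it holds
  that `|g^{(h)}_ω(x)| ≤ Cγ^{3/2 h}`"), packaged with the `∃ c₀` quantifier structure of the F1a facts as
  `norm_bgmSectorProp_le` / `norm_bgmIsoProp_le` — the `N = 0` instances of (2.52)/(2.60).

Everything is proved; no definitions, no named facts, no `sorry`, no axioms beyond the standard three,
no instances, no notation.

## Sources

* [BGM06] G. Benfatto, A. Giuliani, V. Mastropietro, Ann. Henri Poincaré 7 (2006) 809–898,
  arXiv:cond-mat/0507686, §2.3 (2.28), §2.4 (2.42)–(2.42a), §2.5 (2.49)–(2.50), Lemma 2.2 (2.52) and its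
  proof p0010:L129–p0011:L33, Lemma 2.3 (2.60). [BenfattoGiulianiMastropietro2006]
-/

noncomputable section

open Real Set Filter MeasureTheory
open scoped Topology

namespace Literature.MathematicalPhysics.QuantumLattice.FermiRG

/-! ### §1 The sharp support of `f_h` (2.42a), pointwise for any dispersion family -/

section Pointwise

/-- `4^{h-1} = 4^h/4`. [folklore] -/
private theorem four_zpow_sub_one' (h : ℤ) : (4 : ℝ) ^ (h - 1) = (4 : ℝ) ^ h / 4 := by
  rw [zpow_sub_one₀ (by norm_num : (4 : ℝ) ≠ 0)]; ring

/-- `D_h - D_{h-1} = E_h - E_{h-1}`. [folklore] -/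
private theorem bgmDenom_sub_bgmDenom' (μ : ℝ) (E : ℤ → ℝ × (Fin 2 → ℝ) → ℂ) (h : ℤ) (p : ℝ × (Fin 2 → ℝ)) :
    bgmDenom μ E h p - bgmDenom μ E (h - 1) p = E h p - E (h - 1) p := by
  simp only [bgmDenom]; ring

/-- **(2.42a), sharp scale-`h` form**: if `f_h(k) = H₀(γ^{-h}|D_h(k)|) - H₀(γ^{-h+1}|D_{h-1}(k)|) ≠ 0`
((2.28)) for a dispersion family with `|E_h(k) - E_{h-1}(k)| ≤ (3/16)e₀γ^h`, then `|D_h(k)| < e₀γ^h`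
(`H₀(t) = 0` for `t ≥ e₀`, (2.9)): otherwise the first cutoff vanishes, the second is then non-zero,
forcing `|D_{h-1}| < e₀γ^{h-1}` and `|D_h| ≤ e₀γ^{h-1} + (3/16)e₀γ^h < e₀γ^h`.
[cite: BenfattoGiulianiMastropietro2006, §2.4 (2.42a) p0010:L9–L14] -/
theorem norm_bgmDenom_self_lt_of_bgmShell_ne_zero {e₀ μ : ℝ} (he : 0 < e₀) {E : ℤ → ℝ × (Fin 2 → ℝ) → ℂ}
    {h : ℤ} {p : ℝ × (Fin 2 → ℝ)}
    (hη : ‖E h p - E (h - 1) p‖ ≤ 3 / 16 * e₀ * (4 : ℝ) ^ h) (hf : bgmShell e₀ μ E h p ≠ 0) :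
    ‖bgmDenom μ E h p‖ < e₀ * (4 : ℝ) ^ h := by
  have hγ : (1 : ℝ) < 4 := by norm_num
  have h4 : (0 : ℝ) < (4 : ℝ) ^ h := zpow_pos (by norm_num) _
  by_contra hle
  push Not at hle
  have h1 : gnScaleCutoff 4 e₀ h ‖bgmDenom μ E h p‖ = 0 := gnScaleCutoff_eq_zero hγ he hle
  simp only [bgmShell, bgmCutoffInv, h1, zero_sub, neg_ne_zero] at hf
  -- the second cutoff is non-zero, so `|D_{h-1}| < e₀γ^{h-1}`
  have h2 : ‖bgmDenom μ E (h - 1) p‖ < e₀ * (4 : ℝ) ^ (h - 1) := by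
    by_contra hle'
    push Not at hle'
    exact hf (gnScaleCutoff_eq_zero hγ he hle')
  have h3 : ‖bgmDenom μ E h p‖ ≤ ‖bgmDenom μ E (h - 1) p‖ + 3 / 16 * e₀ * (4 : ℝ) ^ h := by
    have := norm_sub_norm_le (bgmDenom μ E h p) (bgmDenom μ E (h - 1) p)
    rw [bgmDenom_sub_bgmDenom'] at this
    linarith
  rw [four_zpow_sub_one'] at h2
  nlinarith

/-- `Re D_h(k) = Re E_h(k) - μ` for the denominator (2.18) `D_h = -ik₀ + E_h - μ`. [cite: BenfattoGiulianiMastropietro2006, §2.3 (2.18) p0007:L17] -/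
theorem bgmDenom_re (μ : ℝ) (E : ℤ → ℝ × (Fin 2 → ℝ) → ℂ) (h : ℤ) (p : ℝ × (Fin 2 → ℝ)) :
    (bgmDenom μ E h p).re = (E h p).re - μ := by
  simp [bgmDenom]

/-- `Im D_h(k) = Im E_h(k) - k₀` for the denominator (2.18) `D_h = -ik₀ + E_h - μ`. [cite: BenfattoGiulianiMastropietro2006, §2.3 (2.18) p0007:L17] -/
theorem bgmDenom_im (μ : ℝ) (E : ℤ → ℝ × (Fin 2 → ℝ) → ℂ) (h : ℤ) (p : ℝ × (Fin 2 → ℝ)) :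
    (bgmDenom μ E h p).im = (E h p).im - p.1 := by
  simp [bgmDenom]; ring

/-- **The level window on the support**: `f_h(k) ≠ 0 ⟹ |Re E_h(k) - μ| < e₀γ^h`.
[cite: BenfattoGiulianiMastropietro2006, §2.4 (2.42a) p0010:L9–L16] -/
theorem abs_re_sub_lt_of_bgmShell_ne_zero {e₀ μ : ℝ} (he : 0 < e₀) {E : ℤ → ℝ × (Fin 2 → ℝ) → ℂ}
    {h : ℤ} {p : ℝ × (Fin 2 → ℝ)}
    (hη : ‖E h p - E (h - 1) p‖ ≤ 3 / 16 * e₀ * (4 : ℝ) ^ h) (hf : bgmShell e₀ μ E h p ≠ 0) :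
    |(E h p).re - μ| < e₀ * (4 : ℝ) ^ h := by
  have h1 := norm_bgmDenom_self_lt_of_bgmShell_ne_zero he hη hf
  rw [← bgmDenom_re]
  exact lt_of_le_of_lt (Complex.abs_re_le_norm _) h1

/-- **The frequency window on the support, imaginary-part form**: `f_h(k) ≠ 0 ⟹ |Im E_h(k) - k₀| < e₀γ^h`.
[cite: BenfattoGiulianiMastropietro2006, §2.4 (2.42a) p0010:L9–L16] -/
theorem abs_im_sub_lt_of_bgmShell_ne_zero {e₀ μ : ℝ} (he : 0 < e₀) {E : ℤ → ℝ × (Fin 2 → ℝ) → ℂ}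
    {h : ℤ} {p : ℝ × (Fin 2 → ℝ)}
    (hη : ‖E h p - E (h - 1) p‖ ≤ 3 / 16 * e₀ * (4 : ℝ) ^ h) (hf : bgmShell e₀ μ E h p ≠ 0) :
    |(E h p).im - p.1| < e₀ * (4 : ℝ) ^ h := by
  have h1 := norm_bgmDenom_self_lt_of_bgmShell_ne_zero he hη hf
  rw [← bgmDenom_im]
  exact lt_of_le_of_lt (Complex.abs_im_le_norm _) h1

end Pointwise

/-! ### §1b The support under the standing hypotheses (2.36), at every scale -/

section Standing

variable {μ e₀ β U c₀ : ℝ} {C : ℕ → ℝ} {hβ : ℤ} {E : ℤ → ℝ × (Fin 2 → ℝ) → ℂ} {h : ℤ}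

/-- `k₀(j) ∈ D_β`. [folklore] -/
private theorem fermiMatsubara_mem' (β : ℝ) (j : ℤ) : fermiMatsubara β j ∈ matsubaraSet β := ⟨j, rfl⟩

/-- The dispersion increment at scale `h` is below the threshold of the support lemmas:
`|E_h - E_{h-1}| ≤ C₀c₀γ^{2h} ≤ (3/16)e₀γ^h` on the Matsubara lattice. [cite: BenfattoGiulianiMastropietro2006, §2.3 (2.36) p0008:L46] -/
theorem norm_E_sub_E_le_threshold (hS : BGMSmoothness β U C hβ E) (hh₁ : hβ ≤ h) (hh₀ : h ≤ 0)
    (hUh : |U| * |(hβ : ℝ)| ≤ c₀) (hK₀ : |C 0| * c₀ ≤ 3 / 16 * e₀) {k₀ : ℝ} (hk₀ : k₀ ∈ matsubaraSet β)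
    (q : Fin 2 → ℝ) :
    ‖E h (k₀, q) - E (h - 1) (k₀, q)‖ ≤ 3 / 16 * e₀ * (4 : ℝ) ^ h := by
  have hc₀ : 0 ≤ c₀ := le_trans (by positivity) hUh
  have h1 := norm_E_sub_E_le hS hh₁ hh₀ hUh hk₀ q
  have h4 : (0 : ℝ) < (4 : ℝ) ^ h := zpow_pos (by norm_num) _
  have : (4 : ℝ) ^ (2 * h) ≤ (4 : ℝ) ^ h := zpow_le_zpow_right₀ (by norm_num) (by omega)
  calc _ ≤ |C 0| * c₀ * (4 : ℝ) ^ (2 * h) := h1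
    _ ≤ |C 0| * c₀ * (4 : ℝ) ^ h := by gcongr
    _ ≤ 3 / 16 * e₀ * (4 : ℝ) ^ h := by gcongr

/-- **The free-band window on the support, every scale**: under (2.36), if `f_h(k₀, q⃗) ≠ 0` at a
Matsubara frequency then `|ε₀(q⃗) - μ| < e₀γ^h + 2C₀c₀` ((2.42a) with (2.42): `|E_h - ε₀| ≤ 2C₀c₀`).
[cite: BenfattoGiulianiMastropietro2006, §2.4 (2.42)–(2.42a) p0009:L101, p0010:L9–L16] -/
theorem abs_sqDispersion_sub_lt_of_bgmShell_ne_zero (hI : BGMInitial E) (hS : BGMSmoothness β U C hβ E)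
    (he : 0 < e₀) (hh₁ : hβ ≤ h) (hh₀ : h ≤ 0) (hU : |U| ≤ c₀) (hUh : |U| * |(hβ : ℝ)| ≤ c₀)
    (hK₀ : |C 0| * c₀ ≤ 3 / 16 * e₀) {j : ℤ} {q : Fin 2 → ℝ}
    (hf : bgmShell e₀ μ E h (fermiMatsubara β j, q) ≠ 0) :
    |sqDispersion q - μ| < e₀ * (4 : ℝ) ^ h + 2 * |C 0| * c₀ := by
  have hk₀ := fermiMatsubara_mem' β j
  have hη := norm_E_sub_E_le_threshold hS hh₁ hh₀ hUh hK₀ hk₀ q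
  have h1 := abs_re_sub_lt_of_bgmShell_ne_zero he hη hf
  have h2 := norm_E_sub_sqDispersion_le hI hS (by omega) hh₀ hk₀ q
  have h3 : |(E h (fermiMatsubara β j, q)).re - sqDispersion q| ≤ 2 * |C 0| * |U| := by
    have := Complex.abs_re_le_norm (E h (fermiMatsubara β j, q) - ((sqDispersion q : ℝ) : ℂ))
    simp only [Complex.sub_re, Complex.ofReal_re] at this
    exact this.trans h2
  have h4 : 2 * |C 0| * |U| ≤ 2 * |C 0| * c₀ := by gcongr
  have := abs_sub_lt_iff.1 h1
  have := abs_le.1 (h3.trans h4)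
  rw [abs_sub_lt_iff]; constructor <;> linarith

/-- `ε₀(q⃗) ≤ -4 + |q⃗|²` (`cos x ≥ 1 - x²/2`). [folklore] -/
private theorem sqDispersion_le_sq_add_sq (q : Fin 2 → ℝ) : sqDispersion q ≤ -4 + (q 0 ^ 2 + q 1 ^ 2) := by
  have h0 := Real.one_sub_sq_div_two_le_cos (x := q 0)
  have h1 := Real.one_sub_sq_div_two_le_cos (x := q 1)
  simp only [sqDispersion]
  linarith

/-- **The support stays away from the origin, every scale**: `f_h(k₀, q⃗) ≠ 0 ⟹ μ + 4 - e₀ - 2C₀c₀ < |q⃗|²`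
(the level window lies above the band bottom `ε₀(0) = -4` since `e₀ < μ + 4`, §2.4 item 1); in
particular the polar angle is smooth on the support. [cite: BenfattoGiulianiMastropietro2006, §2.4 item 1, (2.42a) p0008:L125, p0010:L9] -/
theorem lt_sq_add_sq_of_bgmShell_ne_zero (hI : BGMInitial E) (hS : BGMSmoothness β U C hβ E)
    (he : 0 < e₀) (hh₁ : hβ ≤ h) (hh₀ : h ≤ 0) (hU : |U| ≤ c₀) (hUh : |U| * |(hβ : ℝ)| ≤ c₀)
    (hK₀ : |C 0| * c₀ ≤ 3 / 16 * e₀) {j : ℤ} {q : Fin 2 → ℝ}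
    (hf : bgmShell e₀ μ E h (fermiMatsubara β j, q) ≠ 0) :
    μ + 4 - e₀ - 2 * |C 0| * c₀ < q 0 ^ 2 + q 1 ^ 2 := by
  have h1 := (abs_sub_lt_iff.1 (abs_sqDispersion_sub_lt_of_bgmShell_ne_zero hI hS he hh₁ hh₀ hU hUh hK₀ hf)).2
  have h2 := sqDispersion_le_sq_add_sq q
  have h41 : (4 : ℝ) ^ h ≤ 1 := zpow_le_one_of_nonpos₀ (by norm_num) hh₀
  nlinarith

/-- **The support of a period-cell representative lies in the disc `|q⃗| < π/4`, every scale**: if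
`q⃗ ∈ [-π,π]²` and `f_h(k₀, q⃗) ≠ 0` then `q₁² + q₂² < (π/4)²` (the window `ε₀ < μ + e₀ + 2C₀c₀ < -2-√2`
and the footnote computation `8 arccos(1 - μ - e₀) < 2π` behind (2.40a)). [cite: BenfattoGiulianiMastropietro2006, §2.4 (2.39)–(2.40a) p0009:L14–L20] -/
theorem sq_add_sq_lt_of_bgmShell_ne_zero_of_mem_zoneSq (hI : BGMInitial E) (hS : BGMSmoothness β U C hβ E)
    (he : 0 < e₀) (hh₁ : hβ ≤ h) (hh₀ : h ≤ 0) (hU : |U| ≤ c₀) (hUh : |U| * |(hβ : ℝ)| ≤ c₀)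
    (hμ₁ : -4 < μ) (hK₀ : |C 0| * c₀ ≤ 3 / 16 * e₀) (hgap : μ + e₀ + 2 * |C 0| * c₀ < -2 - Real.sqrt 2)
    {j : ℤ} {q : Fin 2 → ℝ} (hq : q ∈ zoneSq) (hf : bgmShell e₀ μ E h (fermiMatsubara β j, q) ≠ 0) :
    q 0 ^ 2 + q 1 ^ 2 < (π / 4) ^ 2 := by
  have h41 : (4 : ℝ) ^ h ≤ 1 := zpow_le_one_of_nonpos₀ (by norm_num) hh₀
  have hc₀ : 0 ≤ c₀ := (abs_nonneg U).trans hU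
  have h1 := (abs_sub_lt_iff.1 (abs_sqDispersion_sub_lt_of_bgmShell_ne_zero hI hS he hh₁ hh₀ hU hUh hK₀ hf)).1
  have hLv : sqDispersion q ≤ μ + e₀ + 2 * |C 0| * c₀ := by nlinarith
  have hqi : ∀ i, |q i| ≤ π := fun i => abs_le.2 ⟨(hq i (Set.mem_univ i)).1, (hq i (Set.mem_univ i)).2⟩
  have hs2 : 0 ≤ Real.sqrt 2 := Real.sqrt_nonneg 2
  have hCc : 0 ≤ 2 * |C 0| * c₀ := by positivity
  have h2 := sqrt_sq_add_sq_le_umklappRadius (by linarith) hqi hLv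
  have h3 := umklappRadius_lt_pi_div_four (by linarith) hgap
  have hsq : Real.sqrt (q 0 ^ 2 + q 1 ^ 2) < π / 4 := lt_of_le_of_lt h2 h3
  exact (Real.sqrt_lt' (by positivity)).1 hsq

/-- Every planar momentum is a `2πℤ²`-translate of a point of `[-π, π]²`. [folklore] -/
private theorem exists_sub_mem_zoneSq' (q : Fin 2 → ℝ) :
    ∃ z : Fin 2 → ℤ, (q - fun i => 2 * π * (z i : ℝ)) ∈ zoneSq := by
  refine ⟨fun i => ⌊(q i + π) / (2 * π)⌋, fun i _ => ?_⟩
  have h1 := Int.floor_le ((q i + π) / (2 * π))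
  have h2 := Int.lt_floor_add_one ((q i + π) / (2 * π))
  have hπ := Real.two_pi_pos
  rw [le_div_iff₀ hπ] at h1
  rw [div_lt_iff₀ hπ] at h2
  simp only [Pi.sub_apply, Set.mem_Icc]
  constructor <;> nlinarith

/-- In the disc of radius `r` each coordinate is `< r` in absolute value. [folklore] -/
private theorem abs_apply_lt_of_sq_add_sq_lt {r : ℝ} (hr : 0 ≤ r) {q : Fin 2 → ℝ} (hq : q 0 ^ 2 + q 1 ^ 2 < r ^ 2)
    (i : Fin 2) : |q i| < r := by
  have h0 : q 0 ^ 2 < r ^ 2 := by nlinarith [sq_nonneg (q 1)]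
  have h1 : q 1 ^ 2 < r ^ 2 := by nlinarith [sq_nonneg (q 0)]
  fin_cases i
  · exact abs_lt_of_sq_lt_sq h0 hr
  · exact abs_lt_of_sq_lt_sq h1 hr

/-- **The support of `f_h(k₀, ·)` in the plane, every scale**: every point of it is a `2πℤ²`-translate
of a point of the disc `|q⃗| < π/4` — so if its coordinates are `< 7π/4` in absolute value it lies in
that disc itself. [cite: BenfattoGiulianiMastropietro2006, §2.4 (2.39)–(2.40a) p0009:L14–L20] -/
theorem sq_add_sq_lt_of_bgmShell_ne_zero (hI : BGMInitial E) (hS : BGMSmoothness β U C hβ E)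
    (he : 0 < e₀) (hh₁ : hβ ≤ h) (hh₀ : h ≤ 0) (hU : |U| ≤ c₀) (hUh : |U| * |(hβ : ℝ)| ≤ c₀)
    (hμ₁ : -4 < μ) (hK₀ : |C 0| * c₀ ≤ 3 / 16 * e₀) (hgap : μ + e₀ + 2 * |C 0| * c₀ < -2 - Real.sqrt 2)
    {j : ℤ} {q : Fin 2 → ℝ} (hq : ∀ i, |q i| < 7 * π / 4) (hf : bgmShell e₀ μ E h (fermiMatsubara β j, q) ≠ 0) :
    q 0 ^ 2 + q 1 ^ 2 < (π / 4) ^ 2 := by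
  obtain ⟨z, hz⟩ := exists_sub_mem_zoneSq' q
  set q' := q - fun i => 2 * π * (z i : ℝ) with hq'
  have hqq' : q = q' + fun i => 2 * π * (z i : ℝ) := by rw [hq']; abel
  have hf' : bgmShell e₀ μ E h (fermiMatsubara β j, q') ≠ 0 := by
    rwa [hqq', bgmShell_periodic hS] at hf
  have hrad := sq_add_sq_lt_of_bgmShell_ne_zero_of_mem_zoneSq hI hS he hh₁ hh₀ hU hUh hμ₁ hK₀ hgap hz hf'
  have hz0 : ∀ i, z i = 0 := by
    intro i
    have hq'i : |q' i| < π / 4 := abs_apply_lt_of_sq_add_sq_lt (by positivity) hrad i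
    have hzi : |2 * π * (z i : ℝ)| < 2 * π := by
      have e : 2 * π * (z i : ℝ) = q i - q' i := by
        have := congrFun hqq' i; simp only [Pi.add_apply] at this; linarith
      rw [e]
      calc |q i - q' i| ≤ |q i| + |q' i| := abs_sub _ _
        _ < 7 * π / 4 + π / 4 := add_lt_add (hq i) hq'i
        _ = 2 * π := by ring
    rw [abs_mul, abs_of_pos Real.two_pi_pos] at hzi
    have : |(z i : ℝ)| < 1 := by
      by_contra hc; push Not at hc
      have := mul_le_mul_of_nonneg_left hc Real.two_pi_pos.le
      linarith
    exact Int.abs_lt_one_iff.mp (by exact_mod_cast this)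
  have hqeq : q = q' := by
    rw [hqq']; ext i; simp [hz0 i]
  rw [hqeq]; exact hrad

/-- **The shifted integrand sees one period cell, every scale**: if `q⃗ - p⃗ ∈ [-π,π]²` with
`|p_i| < π/4` (the Fermi point of the sector centre) and `f_h(k₀, q⃗) ≠ 0`, then `q₁² + q₂² < (π/4)²`.
[cite: BenfattoGiulianiMastropietro2006, §2.5 (2.46)–(2.49) p0010:L55–L75] -/
theorem sq_add_sq_lt_of_bgmShell_ne_zero_of_sub_mem (hI : BGMInitial E) (hS : BGMSmoothness β U C hβ E)
    (he : 0 < e₀) (hh₁ : hβ ≤ h) (hh₀ : h ≤ 0) (hU : |U| ≤ c₀) (hUh : |U| * |(hβ : ℝ)| ≤ c₀)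
    (hμ₁ : -4 < μ) (hK₀ : |C 0| * c₀ ≤ 3 / 16 * e₀) (hgap : μ + e₀ + 2 * |C 0| * c₀ < -2 - Real.sqrt 2)
    {p : Fin 2 → ℝ} (hp : ∀ i, |p i| < π / 4) {j : ℤ} {q : Fin 2 → ℝ} (hqp : q - p ∈ zoneSq)
    (hf : bgmShell e₀ μ E h (fermiMatsubara β j, q) ≠ 0) :
    q 0 ^ 2 + q 1 ^ 2 < (π / 4) ^ 2 := by
  refine sq_add_sq_lt_of_bgmShell_ne_zero hI hS he hh₁ hh₀ hU hUh hμ₁ hK₀ hgap (fun i => ?_) hf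
  have h1 := hqp i (Set.mem_univ i)
  simp only [Pi.sub_apply, Set.mem_Icc] at h1
  have h2 := abs_lt.1 (hp i)
  rw [abs_lt]; constructor <;> linarith [Real.pi_pos]

end Standing

/-! ### §3 The sector propagators (2.49)/(2.59) at general `x`: a finite Matsubara sum of slices -/

section Representation

variable {μ e₀ β U c₀ : ℝ} {C : ℕ → ℝ} {hβ : ℤ} {E : ℤ → ℝ × (Fin 2 → ℝ) → ℂ} {h : ℤ}

/-- **(2.49) at general `x`, unfolded**: `g(x₀, x⃗) = (1/β) Σ'_j e^{-ik₀(j)x₀} S_j(x⃗)` with the momentum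
slices `S_j(x⃗) = ∫_{[-π,π]²} e^{-ik⃗'·x⃗} F_{h,ω}(k₀(j),k⃗'+p⃗_F)/D_{h-1}(k₀(j),k⃗'+p⃗_F) dk⃗'/(2π)²`,
`k₀(j) = π(2j+1)/β`. [cite: BenfattoGiulianiMastropietro2006, §2.5 (2.49) p0010:L72] -/
theorem bgmGenProp_eq (β e₀ μ : ℝ) (E : ℤ → ℝ × (Fin 2 → ℝ) → ℂ) (h : ℤ) (m ω : ℕ) (x₀ : ℝ) (x : Fin 2 → ℤ) :
    bgmGenProp β e₀ μ E h m ω x₀ x = ((1 / β : ℝ) : ℂ) *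
      ∑' j : ℤ, Complex.exp (-(Complex.I * ((π * (2 * (j : ℝ) + 1) / β * x₀ : ℝ) : ℂ))) •
        ((∫ k in zoneSq, Complex.exp (-(Complex.I * ((dot2 k (fun i => (x i : ℝ)) : ℝ) : ℂ))) *
          (((bgmSectorFn e₀ μ E h m ω
              (fermiMatsubara β j, k + levelRadius (bgmEffDisp β E h) μ (sectorCenter m ω) • dir (sectorCenter m ω)) : ℝ) : ℂ) /
            bgmDenom μ E (h - 1)
              (fermiMatsubara β j, k + levelRadius (bgmEffDisp β E h) μ (sectorCenter m ω) • dir (sectorCenter m ω)))) /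
        (((2 * π) ^ 2 : ℝ) : ℂ)) := by
  unfold bgmGenProp
  congr 1
  refine tsum_congr fun j => ?_
  rw [smul_eq_mul, ← mul_div_assoc, ← integral_const_mul, ← integral_div]
  refine setIntegral_congr_fun (by unfold zoneSq; exact MeasurableSet.univ_pi fun _ => measurableSet_Icc)
    fun k _ => ?_
  have hph : Complex.exp (-(Complex.I * ((fermiMatsubara β j * x₀ + dot2 k (fun i => (x i : ℝ)) : ℝ) : ℂ))) =
      Complex.exp (-(Complex.I * ((π * (2 * (j : ℝ) + 1) / β * x₀ : ℝ) : ℂ))) *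
        Complex.exp (-(Complex.I * ((dot2 k (fun i => (x i : ℝ)) : ℝ) : ℂ))) := by
    rw [← Complex.exp_add, fermiMatsubara]
    congr 1
    push_cast
    ring
  rw [hph]
  ring

/-- **The Matsubara sum is finite** ((2.42a): the slices with `|k₀(j)| > 8e₀γ^h` vanish identically), over
any finite set of frequencies containing `|k₀| ≤ 8e₀γ^h`. [cite: BenfattoGiulianiMastropietro2006, §2.4 (2.42a), §2.5 (2.49) p0010:L9, p0010:L72] -/
theorem bgmGenProp_eq_sum (hI : BGMInitial E) (hSy : BGMSymmetry E) (hS : BGMSmoothness β U C hβ E)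
    (he : 0 < e₀) (hβpos : 0 < β) (hh₁ : hβ ≤ h) (hh₀ : h ≤ 0) (hU : |U| ≤ c₀) (hUh : |U| * |(hβ : ℝ)| ≤ c₀)
    (hK₀ : |C 0| * c₀ ≤ 3 / 16 * e₀) (hK₁ : 2 * |C 1| * c₀ ^ 2 ≤ 1 / 2)
    (hK₂' : 2 * (4 * |C 2| * c₀ ^ 2) * (2 * |C 0| * c₀ + 2 * e₀) ≤ 1) (m ω : ℕ) (x₀ : ℝ) (x : Fin 2 → ℤ)
    {S : Finset ℤ} (hmem : ∀ j, |fermiMatsubara β j| ≤ 8 * e₀ * (4 : ℝ) ^ h → j ∈ S) :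
    bgmGenProp β e₀ μ E h m ω x₀ x = ((1 / β : ℝ) : ℂ) *
      ∑ j ∈ S, Complex.exp (-(Complex.I * ((π * (2 * (j : ℝ) + 1) / β * x₀ : ℝ) : ℂ))) •
        ((∫ k in zoneSq, Complex.exp (-(Complex.I * ((dot2 k (fun i => (x i : ℝ)) : ℝ) : ℂ))) *
          (((bgmSectorFn e₀ μ E h m ω
              (fermiMatsubara β j, k + levelRadius (bgmEffDisp β E h) μ (sectorCenter m ω) • dir (sectorCenter m ω)) : ℝ) : ℂ) /
            bgmDenom μ E (h - 1)
              (fermiMatsubara β j, k + levelRadius (bgmEffDisp β E h) μ (sectorCenter m ω) • dir (sectorCenter m ω)))) /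
        (((2 * π) ^ 2 : ℝ) : ℂ)) := by
  rw [bgmGenProp_eq, tsum_eq_sum (s := S)]
  intro j hj
  have hf : ∀ q, bgmShell e₀ μ E h (fermiMatsubara β j, q) = 0 := fun q => by
    by_contra hf
    exact hj (hmem j (abs_k0_lt_of_bgmShell_ne_zero hI hSy hS he hβpos hh₁ hh₀ hU hUh hK₀ hK₁ hK₂' hf).le)
  simp [bgmSectorFn, hf]

/-- **The support interval of the Matsubara index**: `|k₀(j)| ≤ R ⟹ j ∈ Icc (-K) K` with
`K = ⌈Rβ/2π⌉`, so the slices vanish off `Icc (-K) K` for `R = 8e₀γ^h`. [cite: BenfattoGiulianiMastropietro2006, §2.4 (2.42a) p0010:L9] -/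
theorem slice_eq_zero_of_not_mem_Icc (hI : BGMInitial E) (hSy : BGMSymmetry E) (hS : BGMSmoothness β U C hβ E)
    (he : 0 < e₀) (hβpos : 0 < β) (hh₁ : hβ ≤ h) (hh₀ : h ≤ 0) (hU : |U| ≤ c₀) (hUh : |U| * |(hβ : ℝ)| ≤ c₀)
    (hK₀ : |C 0| * c₀ ≤ 3 / 16 * e₀) (hK₁ : 2 * |C 1| * c₀ ^ 2 ≤ 1 / 2)
    (hK₂' : 2 * (4 * |C 2| * c₀ ^ 2) * (2 * |C 0| * c₀ + 2 * e₀) ≤ 1) (m ω : ℕ) (x : Fin 2 → ℤ)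
    (p : Fin 2 → ℝ) (j : ℤ)
    (hj : j ∉ Finset.Icc (-(⌈8 * e₀ * (4 : ℝ) ^ h * β / (2 * π)⌉₊ : ℤ)) (⌈8 * e₀ * (4 : ℝ) ^ h * β / (2 * π)⌉₊ : ℤ)) :
    (∫ k in zoneSq, Complex.exp (-(Complex.I * ((dot2 k (fun i => (x i : ℝ)) : ℝ) : ℂ))) *
        (((bgmSectorFn e₀ μ E h m ω (fermiMatsubara β j, k + p) : ℝ) : ℂ) /
          bgmDenom μ E (h - 1) (fermiMatsubara β j, k + p))) / (((2 * π) ^ 2 : ℝ) : ℂ) = 0 := by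
  have hf : ∀ q, bgmShell e₀ μ E h (fermiMatsubara β j, q) = 0 := fun q => by
    by_contra hf
    exact hj (natAbs_le_of_abs_fermiMatsubara_le hβpos
      (abs_k0_lt_of_bgmShell_ne_zero hI hSy hS he hβpos hh₁ hh₀ hU hUh hK₀ hK₁ hK₂' hf).le)
  simp [bgmSectorFn, hf]

end Representation

/-! ### §4 The real part of the moving dispersion at one Matsubara frequency: a `C¹`-small perturbation
of `ε₀`, and the radial localisation of the support -/

section Radial

variable {μ e₀ β U c₀ : ℝ} {C : ℕ → ℝ} {hβ : ℤ} {E : ℤ → ℝ × (Fin 2 → ℝ) → ℂ} {h : ℤ}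

/-- `Σ_{m<n} m4^{-m} ≤ 2`. [folklore] -/
private theorem sum_mul_zpow_neg_le'' (n : ℕ) : ∑ m ∈ Finset.range n, (m : ℝ) * (4 : ℝ) ^ (-(m : ℤ)) ≤ 2 := by
  have hterm : ∀ m : ℕ, (m : ℝ) * (4 : ℝ) ^ (-(m : ℤ)) ≤ (1 / 2 : ℝ) ^ m := by
    intro m
    have h4 : (0 : ℝ) < 4 ^ m := by positivity
    have h2 : (0 : ℝ) < 2 ^ m := by positivity
    rw [zpow_neg, zpow_natCast, one_div, inv_pow, mul_inv_le_iff₀ h4]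
    have h42 : (2 ^ m)⁻¹ * (4 : ℝ) ^ m = 2 ^ m := by
      rw [show (4 : ℝ) ^ m = 2 ^ m * 2 ^ m by rw [← mul_pow]; norm_num, ← mul_assoc,
        inv_mul_cancel₀ h2.ne', one_mul]
    rw [h42]
    exact_mod_cast (Nat.lt_two_pow_self (n := m)).le
  calc ∑ m ∈ Finset.range n, (m : ℝ) * (4 : ℝ) ^ (-(m : ℤ)) ≤ ∑ m ∈ Finset.range n, (1 / 2 : ℝ) ^ m :=
        Finset.sum_le_sum fun m _ => hterm m
    _ ≤ 2 := sum_geometric_two_le n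

/-- `‖L v‖ ≤ |v₁|‖L e₁‖ + |v₂|‖L e₂‖` for a linear map on `ℝ²`. [folklore] -/
private theorem norm_clm_apply_le_basis' {F : Type*} [NormedAddCommGroup F] [NormedSpace ℝ F]
    (L : (Fin 2 → ℝ) →L[ℝ] F) {B : ℝ} (h0 : ‖L (Pi.single 0 1)‖ ≤ B) (h1 : ‖L (Pi.single 1 1)‖ ≤ B)
    (v : Fin 2 → ℝ) : ‖L v‖ ≤ B * (|v 0| + |v 1|) := by
  have hv : v = v 0 • (Pi.single 0 1 : Fin 2 → ℝ) + v 1 • (Pi.single 1 1 : Fin 2 → ℝ) := by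
    ext i; fin_cases i <;> simp
  have hB : 0 ≤ B := (norm_nonneg _).trans h0
  calc ‖L v‖ = ‖v 0 • L (Pi.single 0 1) + v 1 • L (Pi.single 1 1)‖ := by
        conv_lhs => rw [hv]
        rw [map_add, map_smul, map_smul]
    _ ≤ ‖v 0 • L (Pi.single 0 1)‖ + ‖v 1 • L (Pi.single 1 1)‖ := norm_add_le _ _
    _ = |v 0| * ‖L (Pi.single 0 1)‖ + |v 1| * ‖L (Pi.single 1 1)‖ := by
        rw [norm_smul, norm_smul, Real.norm_eq_abs, Real.norm_eq_abs]
    _ ≤ |v 0| * B + |v 1| * B := by gcongr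
    _ = B * (|v 0| + |v 1|) := by ring

/-- **`Re E_h(k₀, ·)` is a `C¹`-small `C²` perturbation of `ε₀`** at every Matsubara frequency and every
scale `h_β ≤ h ≤ 0` (telescoping (2.36) as in (2.41a)/(2.42): `|Re E_h - ε₀| ≤ 2C₀|U|`,
`|∇(Re E_h - ε₀)·v| ≤ 2C₁U²(|v₁| + |v₂|)`). [cite: BenfattoGiulianiMastropietro2006, §2.4 (2.41a)–(2.42) p0009:L77–L101] -/
theorem re_slice_perturbation (hI : BGMInitial E) (hS : BGMSmoothness β U C hβ E) (hh₁ : hβ ≤ h) (hh₀ : h ≤ 0)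
    {k₀ : ℝ} (hk₀ : k₀ ∈ matsubaraSet β) :
    ContDiff ℝ 2 (fun q => (E h (k₀, q)).re) ∧
    (∀ q, |(E h (k₀, q)).re - sqDispersion q| ≤ 2 * |C 0| * |U|) ∧
    (∀ q v, |fderiv ℝ (fun q => (E h (k₀, q)).re) q v - fderiv ℝ sqDispersion q v| ≤
        2 * |C 1| * U ^ 2 * (|v 0| + |v 1|)) := by
  have hS1 := hS.1
  set n := (-h).toNat with hn
  have hmem : ∀ m ∈ Finset.range n, hβ ≤ -(m : ℤ) := fun m hm => by
    have := Finset.mem_range.1 hm; omega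
  set g : ℕ → (Fin 2 → ℝ) → ℂ := fun m q => E (-(m : ℤ)) (k₀, q) - E (-(m : ℤ) - 1) (k₀, q) with hg
  have hslice : ∀ (j : ℤ), ContDiff ℝ 2 (fun q => E j (k₀, q)) := fun j => hS1 j k₀ 2
  have hgd : ∀ m, ContDiff ℝ 2 (g m) := fun m => (hslice _).sub (hslice _)
  -- the identity `E_h(k₀, q) = ε₀(q) - Σ g_m(q)`
  have hE : ∀ q, E h (k₀, q) = ((sqDispersion q : ℝ) : ℂ) - ∑ m ∈ Finset.range n, g m q := fun q => by
    rw [bgm_telescope E hh₀ (k₀, q), hI]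
  refine ⟨Complex.reCLM.contDiff.comp (hslice h), fun q => ?_, fun q v => ?_⟩
  · rw [hE q]
    simp only [Complex.sub_re, Complex.ofReal_re, sub_sub_cancel_left, abs_neg]
    calc |(∑ m ∈ Finset.range n, g m q).re| ≤ ‖∑ m ∈ Finset.range n, g m q‖ := Complex.abs_re_le_norm _
      _ ≤ ∑ m ∈ Finset.range n, ‖g m q‖ := norm_sum_le _ _
      _ ≤ ∑ m ∈ Finset.range n, |C 0| * |U| * ((m : ℝ) * (4 : ℝ) ^ (2 * (-(m : ℤ)))) :=
          Finset.sum_le_sum fun m hm => (bgm_diff_bounds hS (hmem m hm) hk₀ q).1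
      _ = |C 0| * |U| * ∑ m ∈ Finset.range n, (m : ℝ) * (4 : ℝ) ^ (2 * (-(m : ℤ))) := by rw [Finset.mul_sum]
      _ ≤ |C 0| * |U| * ∑ m ∈ Finset.range n, (m : ℝ) * (4 : ℝ) ^ (-(m : ℤ)) := by
          refine mul_le_mul_of_nonneg_left (Finset.sum_le_sum fun m _ => ?_) (by positivity)
          exact mul_le_mul_of_nonneg_left (zpow_le_zpow_right₀ (by norm_num) (by omega)) (Nat.cast_nonneg _)
      _ ≤ |C 0| * |U| * 2 := by gcongr; exact sum_mul_zpow_neg_le'' n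
      _ = 2 * |C 0| * |U| := by ring
  · -- the derivative through `HasFDerivAt`
    have hεd : HasFDerivAt (fun q => ((sqDispersion q : ℝ) : ℂ)) (Complex.ofRealCLM.comp (fderiv ℝ sqDispersion q)) q :=
      Complex.ofRealCLM.hasFDerivAt.comp q
        ((contDiff_sqDispersion (m := 1)).differentiable (by simp) q).hasFDerivAt
    have hgq : ∀ m ∈ Finset.range n, HasFDerivAt (g m) (fderiv ℝ (g m) q) q := fun m _ =>
      (((hgd m).differentiable (by norm_num)) q).hasFDerivAt
    have hsum : HasFDerivAt (fun q => ∑ m ∈ Finset.range n, g m q) (∑ m ∈ Finset.range n, fderiv ℝ (g m) q) q :=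
      HasFDerivAt.fun_sum hgq
    have hEq : (fun q => E h (k₀, q)) = fun q => ((sqDispersion q : ℝ) : ℂ) - ∑ m ∈ Finset.range n, g m q := by
      funext q; exact hE q
    have hslice' : HasFDerivAt (fun q => E h (k₀, q))
        (Complex.ofRealCLM.comp (fderiv ℝ sqDispersion q) - ∑ m ∈ Finset.range n, fderiv ℝ (g m) q) q := by
      rw [hEq]; exact hεd.sub hsum
    have hre : HasFDerivAt (fun q => (E h (k₀, q)).re)
        (Complex.reCLM.comp (Complex.ofRealCLM.comp (fderiv ℝ sqDispersion q) - ∑ m ∈ Finset.range n, fderiv ℝ (g m) q)) q :=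
      Complex.reCLM.hasFDerivAt.comp q hslice'
    rw [hre.fderiv]
    simp only [ContinuousLinearMap.comp_apply, sub_apply, sum_apply,
      Complex.reCLM_apply, Complex.sub_re, Complex.ofRealCLM_apply, Complex.ofReal_re, sub_sub_cancel_left,
      abs_neg]
    calc |(∑ m ∈ Finset.range n, fderiv ℝ (g m) q v).re| ≤ ‖∑ m ∈ Finset.range n, fderiv ℝ (g m) q v‖ :=
          Complex.abs_re_le_norm _
      _ ≤ ∑ m ∈ Finset.range n, ‖fderiv ℝ (g m) q v‖ := norm_sum_le _ _
      _ ≤ ∑ m ∈ Finset.range n, |C 1| * U ^ 2 * ((m : ℝ) * (4 : ℝ) ^ (-(m : ℤ))) * (|v 0| + |v 1|) :=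
          Finset.sum_le_sum fun m hm => by
            have hb := (bgm_diff_bounds hS (hmem m hm) hk₀ q).2.1
            exact norm_clm_apply_le_basis' _ (hb 0) (hb 1) v
      _ = |C 1| * U ^ 2 * (|v 0| + |v 1|) * ∑ m ∈ Finset.range n, (m : ℝ) * (4 : ℝ) ^ (-(m : ℤ)) := by
          rw [Finset.mul_sum]; refine Finset.sum_congr rfl fun m _ => ?_; ring
      _ ≤ |C 1| * U ^ 2 * (|v 0| + |v 1|) * 2 := by gcongr; exact sum_mul_zpow_neg_le'' n
      _ = 2 * |C 1| * U ^ 2 * (|v 0| + |v 1|) := by ring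

/-- `(ρe⃗_r)₁² + (ρe⃗_r)₂² = ρ²`. [folklore] -/
private theorem sq_add_sq_smul_dir' (ρ θ : ℝ) : (ρ • dir θ) 0 ^ 2 + (ρ • dir θ) 1 ^ 2 = ρ ^ 2 := by
  simp only [Pi.smul_apply, smul_eq_mul, dir_zero, dir_one]
  nlinarith [Real.sin_sq_add_cos_sq θ]

/-- `|(ρe⃗_r)ᵢ| ≤ |ρ|`. [folklore] -/
private theorem abs_smul_dir_apply_le (ρ θ : ℝ) (i : Fin 2) : |(ρ • dir θ) i| ≤ |ρ| := by
  have hc := Real.abs_cos_le_one θ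
  have hs := Real.abs_sin_le_one θ
  fin_cases i
  · simp only [Pi.smul_apply, smul_eq_mul, dir_zero, abs_mul, Fin.zero_eta]
    exact mul_le_of_le_one_right (abs_nonneg ρ) hc
  · simp only [Pi.smul_apply, smul_eq_mul, dir_one, abs_mul, Fin.mk_one]
    exact mul_le_of_le_one_right (abs_nonneg ρ) hs

/-- **The radial window at one Matsubara frequency, every scale** (closed form): with
`ε = Re E_h(k₀(j), ·)`, `c = √((μ + 4 - e₀)/2)` and `u(θ) = levelRadius ε μ θ` (the point of the level
curve `ε = μ` on the ray of angle `θ`), under (2.36) with `c₀` small: `u(θ)` is the root, it lies in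
`[c, π/4)`, and every `ρ ∈ [c, π/2]` with `|ε(ρe⃗_r(θ)) - μ| ≤ η` has `|ρ - u(θ)| ≤ η/m`, `m = 2c/π`
(the transversality (2.41) `c₁ ≤ ∂_ρ ε_h ≤ c₂`: "the measure of the support"). [cite: BenfattoGiulianiMastropietro2006, §2.4 (2.41) p0009:L55, §2.5 proof of Lemma 2.2 p0011:L3–L6] -/
theorem radial_window (hI : BGMInitial E) (hS : BGMSmoothness β U C hβ E)
    (he : 0 < e₀) (hh₁ : hβ ≤ h) (hh₀ : h ≤ 0) (hU : |U| ≤ c₀)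
    (hgap : μ + e₀ + 2 * |C 0| * c₀ < -2 - Real.sqrt 2)
    (hgap' : 2 * |C 0| * c₀ ≤ (μ + 4 - e₀) / 2) (he4 : e₀ < μ + 4)
    (hδ₁ : 2 * (2 * |C 1| * c₀ ^ 2) ≤ 2 / π * Real.sqrt ((μ + 4 - e₀) / 2))
    (j : ℤ) (θ : ℝ) :
    IsLevelRadius (fun q => (E h (fermiMatsubara β j, q)).re) μ θ
        (levelRadius (fun q => (E h (fermiMatsubara β j, q)).re) μ θ) ∧
      Real.sqrt ((μ + 4 - e₀) / 2) ≤ levelRadius (fun q => (E h (fermiMatsubara β j, q)).re) μ θ ∧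
      levelRadius (fun q => (E h (fermiMatsubara β j, q)).re) μ θ < π / 4 ∧
      ∀ (η ρ : ℝ), Real.sqrt ((μ + 4 - e₀) / 2) ≤ ρ → ρ ≤ π / 2 →
        |(E h (fermiMatsubara β j, ρ • dir θ)).re - μ| ≤ η →
        |ρ - levelRadius (fun q => (E h (fermiMatsubara β j, q)).re) μ θ| ≤
          η / (2 / π * Real.sqrt ((μ + 4 - e₀) / 2)) := by
  set c := Real.sqrt ((μ + 4 - e₀) / 2) with hc
  have hπ := Real.pi_pos
  have hc0 : 0 < c := Real.sqrt_pos.2 (by linarith)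
  have hcsq : c ^ 2 = (μ + 4 - e₀) / 2 := Real.sq_sqrt (by linarith)
  have hc₀ : 0 ≤ c₀ := (abs_nonneg U).trans hU
  have hk₀ := fermiMatsubara_mem' β j
  obtain ⟨hεd, h0', h1'⟩ := re_slice_perturbation hI hS hh₁ hh₀ hk₀
  set ε : (Fin 2 → ℝ) → ℝ := fun q => (E h (fermiMatsubara β j, q)).re with hε
  have h0 : ∀ q, |ε q - sqDispersion q| ≤ 2 * |C 0| * c₀ := fun q => (h0' q).trans (by gcongr)
  have hUsq : U ^ 2 ≤ c₀ ^ 2 := by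
    rw [← sq_abs U]; exact pow_le_pow_left₀ (abs_nonneg U) hU 2
  have h1 : ∀ q v, |fderiv ℝ ε q v - fderiv ℝ sqDispersion q v| ≤ (2 * |C 1| * c₀ ^ 2) * (|v 0| + |v 1|) :=
    fun q v => (h1' q v).trans (by gcongr)
  have hδ₁0 : 0 ≤ 2 * |C 1| * c₀ ^ 2 := by positivity
  have h24 : 2 / π * c < 4 / π * c := by
    rw [div_mul_eq_mul_div, div_mul_eq_mul_div]
    exact div_lt_div_of_pos_right (by linarith) hπ
  have hcδ : 2 * (2 * |C 1| * c₀ ^ 2) < 4 / π * c := lt_of_le_of_lt hδ₁ h24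
  have hlev : μ ∈ Ioo (c ^ 2 + 2 * |C 0| * c₀ - 4) (-2 - Real.sqrt 2 - 2 * |C 0| * c₀) := by
    rw [hcsq]; constructor <;> linarith
  obtain ⟨hroot, hcu, huK, hK⟩ := levelRadius_bounds hεd h0 hδ₁0 hcδ hlev θ
  refine ⟨hroot, hcu, lt_of_le_of_lt huK hK, fun η ρ hρc hρπ hη => ?_⟩
  have hum : ε (levelRadius ε μ θ • dir θ) = μ := hroot.2
  have hsep := mul_abs_sub_le_abs_eps_sub hεd h1 hδ₁0 hc0.le θ
    (s := ρ) (t := levelRadius ε μ θ) ⟨hρc, hρπ⟩ ⟨hcu, hroot.1.2⟩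
  have hm : 2 / π * c ≤ 4 / π * c - 2 * (2 * |C 1| * c₀ ^ 2) := by
    have : 4 / π * c = 2 / π * c + 2 / π * c := by ring
    linarith
  have hmpos : 0 < 2 / π * c := by positivity
  rw [hum] at hsep
  rw [le_div_iff₀ hmpos]
  calc |ρ - levelRadius ε μ θ| * (2 / π * c)
      ≤ (4 / π * c - 2 * (2 * |C 1| * c₀ ^ 2)) * |ρ - levelRadius ε μ θ| := by
        rw [mul_comm]; exact mul_le_mul_of_nonneg_right hm (abs_nonneg _)
    _ ≤ |ε (ρ • dir θ) - μ| := hsep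
    _ ≤ η := hη

/-- **On the support, along a ray**: `f_h(k₀(j), ρe⃗_r(θ)) ≠ 0` with `0 < ρ < 3π/4` forces
`c ≤ ρ < π/4` and `|Re E_h(k₀(j), ρe⃗_r(θ)) - μ| < e₀γ^h` (§1 on the ray). [cite: BenfattoGiulianiMastropietro2006, §2.4 (2.42a) p0010:L9–L16] -/
theorem ray_support_of_bgmShell_ne_zero (hI : BGMInitial E) (hS : BGMSmoothness β U C hβ E)
    (he : 0 < e₀) (hh₁ : hβ ≤ h) (hh₀ : h ≤ 0) (hU : |U| ≤ c₀) (hUh : |U| * |(hβ : ℝ)| ≤ c₀)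
    (hμ₁ : -4 < μ) (hK₀ : |C 0| * c₀ ≤ 3 / 16 * e₀) (hgap : μ + e₀ + 2 * |C 0| * c₀ < -2 - Real.sqrt 2)
    (hgap' : 2 * |C 0| * c₀ ≤ (μ + 4 - e₀) / 2) (he4 : e₀ < μ + 4)
    {j : ℤ} {ρ θ : ℝ} (hρ : ρ ∈ Ioo (0 : ℝ) (3 * π / 4))
    (hf : bgmShell e₀ μ E h (fermiMatsubara β j, ρ • dir θ) ≠ 0) :
    Real.sqrt ((μ + 4 - e₀) / 2) ≤ ρ ∧ ρ < π / 4 ∧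
      |(E h (fermiMatsubara β j, ρ • dir θ)).re - μ| < e₀ * (4 : ℝ) ^ h := by
  have hk₀ := fermiMatsubara_mem' β j
  have hη := norm_E_sub_E_le_threshold hS hh₁ hh₀ hUh hK₀ hk₀ (ρ • dir θ)
  have hwin := abs_re_sub_lt_of_bgmShell_ne_zero he hη hf
  have hball : (ρ • dir θ) 0 ^ 2 + (ρ • dir θ) 1 ^ 2 < (π / 4) ^ 2 :=
    sq_add_sq_lt_of_bgmShell_ne_zero hI hS he hh₁ hh₀ hU hUh hμ₁ hK₀ hgap (fun i =>
      lt_of_le_of_lt (abs_smul_dir_apply_le ρ θ i) (by rw [abs_of_pos hρ.1]; linarith [hρ.2, Real.pi_pos])) hf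
  rw [sq_add_sq_smul_dir'] at hball
  have hρπ : ρ < π / 4 := by nlinarith [hρ.1, Real.pi_pos]
  have hann := lt_sq_add_sq_of_bgmShell_ne_zero hI hS he hh₁ hh₀ hU hUh hK₀ hf
  rw [sq_add_sq_smul_dir'] at hann
  have hc0 : 0 < Real.sqrt ((μ + 4 - e₀) / 2) := Real.sqrt_pos.2 (by linarith)
  have hcsq : Real.sqrt ((μ + 4 - e₀) / 2) ^ 2 = (μ + 4 - e₀) / 2 := Real.sq_sqrt (by linarith)
  have hρc : Real.sqrt ((μ + 4 - e₀) / 2) ≤ ρ := by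
    have h4 : Real.sqrt ((μ + 4 - e₀) / 2) ^ 2 ≤ ρ ^ 2 := by nlinarith
    exact (pow_le_pow_iff_left₀ hc0.le hρ.1.le two_ne_zero).1 h4
  exact ⟨hρc, hρπ, hwin⟩

/-- **Radial localisation of the support at one Matsubara frequency, every scale**:
`f_h(k₀(j), ρe⃗_r(θ)) ≠ 0` with `0 < ρ < 3π/4` forces `|ρ - u(θ)| ≤ e₀γ^h/m` with `u(θ)` the level radius of
`Re E_h(k₀(j), ·) = μ` and `m = 2c/π`: along each ray the support is an interval of length `≤ 2e₀γ^h/m`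
(BGM p0011:L4–L6). [cite: BenfattoGiulianiMastropietro2006, §2.5 proof of Lemma 2.2 p0011:L3–L6, §2.4 (2.41) p0009:L55] -/
theorem radial_localisation (hI : BGMInitial E) (hS : BGMSmoothness β U C hβ E)
    (he : 0 < e₀) (hh₁ : hβ ≤ h) (hh₀ : h ≤ 0) (hU : |U| ≤ c₀) (hUh : |U| * |(hβ : ℝ)| ≤ c₀)
    (hμ₁ : -4 < μ) (hK₀ : |C 0| * c₀ ≤ 3 / 16 * e₀) (hgap : μ + e₀ + 2 * |C 0| * c₀ < -2 - Real.sqrt 2)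
    (hgap' : 2 * |C 0| * c₀ ≤ (μ + 4 - e₀) / 2) (he4 : e₀ < μ + 4)
    (hδ₁ : 2 * (2 * |C 1| * c₀ ^ 2) ≤ 2 / π * Real.sqrt ((μ + 4 - e₀) / 2))
    {j : ℤ} {ρ θ : ℝ} (hρ : ρ ∈ Ioo (0 : ℝ) (3 * π / 4))
    (hf : bgmShell e₀ μ E h (fermiMatsubara β j, ρ • dir θ) ≠ 0) :
    ρ ≤ π / 4 ∧ |ρ - levelRadius (fun q => (E h (fermiMatsubara β j, q)).re) μ θ| ≤
      e₀ * (4 : ℝ) ^ h / (2 / π * Real.sqrt ((μ + 4 - e₀) / 2)) := by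
  obtain ⟨hρc, hρπ, hwin⟩ := ray_support_of_bgmShell_ne_zero hI hS he hh₁ hh₀ hU hUh hμ₁ hK₀ hgap hgap' he4 hρ hf
  obtain ⟨-, -, -, hwin'⟩ := radial_window hI hS he hh₁ hh₀ hU hgap hgap' he4 hδ₁ j θ
  exact ⟨hρπ.le, hwin' _ ρ hρc (by linarith [Real.pi_pos]) hwin.le⟩

end Radial

/-! ### §5 Integration over the support in polar coordinates, and the dimensional bound (2.50) at
every `x` and every scale -/

section Support

variable {μ e₀ β U c₀ : ℝ} {C : ℕ → ℝ} {hβ : ℤ} {E : ℤ → ℝ × (Fin 2 → ℝ) → ℂ} {h : ℤ}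

/-- `e⃗_r` is continuous. [folklore] -/
private theorem continuous_dir'' : Continuous dir :=
  continuous_iff_continuousAt.2 fun θ => (hasDerivAt_dir θ).continuousAt

/-- The polar angle of a ray point: `θ(ρe⃗_r(θ)) = θ` for `ρ > 0`, `θ ∈ (-π, π]`. [folklore] -/
private theorem polarAngle_smul_dir' {ρ θ : ℝ} (hρ : 0 < ρ) (hθ : θ ∈ Ioc (-π) π) :
    polarAngle (ρ • dir θ) = θ := by
  unfold polarAngle
  have : momToComplex (ρ • dir θ) = ρ * (Complex.cos θ + Complex.sin θ * Complex.I) := by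
    apply Complex.ext <;> simp [momToComplex, Complex.cos_ofReal_re, Complex.sin_ofReal_re]
  rw [this]
  exact Complex.arg_mul_cos_add_sin_mul_I hρ hθ

/-- Polar coordinates on the disc for a real integrand: `∫ 1_{B_r} G = ∫_{(0,r)×(-π,π)} ρ G(ρe⃗_r(θ))`. [folklore] -/
private theorem integral_indicator_ball_eq_polar_real (G : (Fin 2 → ℝ) → ℝ) {r : ℝ} (hr : 0 < r) :
    ∫ q, {q : Fin 2 → ℝ | q 0 ^ 2 + q 1 ^ 2 < r ^ 2}.indicator G q =
      ∫ p in Ioo 0 r ×ˢ Ioo (-π) π, p.1 * G (p.1 • dir p.2) := by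
  have h := integral_indicator_ball_eq_polar (fun q => ((G q : ℝ) : ℂ)) hr
  have h1 : (∫ q, ({q : Fin 2 → ℝ | q 0 ^ 2 + q 1 ^ 2 < r ^ 2}.indicator fun q => ((G q : ℝ) : ℂ)) q) =
      ((∫ q, {q : Fin 2 → ℝ | q 0 ^ 2 + q 1 ^ 2 < r ^ 2}.indicator G q : ℝ) : ℂ) := by
    rw [← integral_complex_ofReal]
    congr 1; funext q
    by_cases hq : q ∈ {q : Fin 2 → ℝ | q 0 ^ 2 + q 1 ^ 2 < r ^ 2}
    · rw [Set.indicator_of_mem hq, Set.indicator_of_mem hq]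
    · rw [Set.indicator_of_notMem hq, Set.indicator_of_notMem hq, Complex.ofReal_zero]
  have h2 : (∫ p in Ioo 0 r ×ˢ Ioo (-π) π, (p.1 : ℂ) * ((G (p.1 • dir p.2) : ℝ) : ℂ)) =
      ((∫ p in Ioo 0 r ×ˢ Ioo (-π) π, p.1 * G (p.1 • dir p.2) : ℝ) : ℂ) := by
    rw [← integral_complex_ofReal]
    congr 1; funext p; push_cast; ring
  rw [h1, h2] at h
  exact_mod_cast h

/-- Fubini with the angle outermost (real integrand). [folklore] -/
private theorem setIntegral_prod_symm_real (f : ℝ × ℝ → ℝ) {s t : Set ℝ}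
    (hf : IntegrableOn f (s ×ˢ t) (volume.prod volume)) :
    ∫ z in s ×ˢ t, f z = ∫ y in t, ∫ x in s, f (x, y) := by
  have hf' : Integrable f ((volume.restrict s).prod (volume.restrict t)) := by
    rw [Measure.prod_restrict]; exact hf
  rw [Measure.volume_eq_prod, ← Measure.prod_restrict]
  exact integral_prod_symm f hf'

/-- A measurable function bounded on a product of bounded intervals is integrable there (real). [folklore] -/
private theorem integrableOn_prod_Ioo_of_bound_real {f : ℝ × ℝ → ℝ} (hf : Measurable f) {a b c d M : ℝ}
    (hM : ∀ p ∈ Ioo a b ×ˢ Ioo c d, ‖f p‖ ≤ M) :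
    IntegrableOn f (Ioo a b ×ˢ Ioo c d) (volume.prod volume) := by
  refine IntegrableOn.of_bound ?_ hf.aestronglyMeasurable M ?_
  · rw [Measure.prod_prod]
    exact ENNReal.mul_lt_top (by simp [Real.volume_Ioo]) (by simp [Real.volume_Ioo])
  · exact (ae_restrict_iff' (measurableSet_Ioo.prod measurableSet_Ioo)).2 (Eventually.of_forall hM)

/-- The inner integrals of an integrable function on the product are integrable (real). [folklore] -/
private theorem integrableOn_inner_real {f : ℝ × ℝ → ℝ} {s t : Set ℝ}
    (hf : IntegrableOn f (s ×ˢ t) (volume.prod volume)) :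
    IntegrableOn (fun y => ∫ x in s, f (x, y)) t := by
  have hf' : Integrable f ((volume.restrict s).prod (volume.restrict t)) := by
    rw [Measure.prod_restrict]; exact hf
  exact hf'.integral_prod_right

/-- **Integration over the support in polar coordinates** ("the measure of the support", every scale):
if a measurable `0 ≤ g ≤ M` on momentum space vanishes at `ρe⃗_r(θ)` (`0 < ρ < 3π/4`, `-π < θ < π`) unless
`ρ ≤ π/4`, `|ρ - u(θ)| ≤ w_r` (a radial window around a ray-dependent radius) and
`|θ - θ₀ - 2πj| ≤ w_a` for an integer `j` (an angular window around `θ₀ ∈ [0, 2π]`, `w_a ≤ π`), then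
`∫_{|q⃗| < 3π/4} g ≤ 6w_a · (π/4) M · 2w_r`. [cite: BenfattoGiulianiMastropietro2006, §2.5 proof of Lemma 2.2 p0011:L3–L6] -/
theorem integral_indicator_ball_le_of_support {g : (Fin 2 → ℝ) → ℝ} (hgm : Measurable g)
    (hg0 : ∀ q, 0 ≤ g q) {M : ℝ} (hM0 : 0 ≤ M) (hM : ∀ q, g q ≤ M) {θ₀ wa wr : ℝ}
    (hθ₀ : θ₀ ∈ Icc 0 (2 * π)) (hwa0 : 0 ≤ wa) (hwa : wa ≤ π) (hwr : 0 ≤ wr) (u : ℝ → ℝ)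
    (hsupp : ∀ ρ θ, ρ ∈ Ioo 0 (3 * π / 4) → θ ∈ Ioo (-π) π → g (ρ • dir θ) ≠ 0 →
      ρ ≤ π / 4 ∧ |ρ - u θ| ≤ wr ∧ ∃ j : ℤ, |θ - θ₀ - 2 * π * j| ≤ wa) :
    ∫ q, {q : Fin 2 → ℝ | q 0 ^ 2 + q 1 ^ 2 < (3 * π / 4) ^ 2}.indicator g q ≤
      6 * wa * (π / 4 * M * (2 * wr)) := by
  have hπ := Real.pi_pos
  have hr : (0 : ℝ) < 3 * π / 4 := by positivity
  rw [integral_indicator_ball_eq_polar_real g hr]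
  set F : ℝ × ℝ → ℝ := fun p => p.1 * g (p.1 • dir p.2) with hF
  have hFm : Measurable F :=
    measurable_fst.mul (hgm.comp (continuous_fst.smul (continuous_dir''.comp continuous_snd)).measurable)
  have hFint : IntegrableOn F (Ioo 0 (3 * π / 4) ×ˢ Ioo (-π) π) (volume.prod volume) := by
    refine integrableOn_prod_Ioo_of_bound_real hFm (M := 3 * π / 4 * M) fun p hp => ?_
    have hp1 : 0 < p.1 := hp.1.1
    rw [Real.norm_eq_abs, hF, abs_mul, abs_of_pos hp1, abs_of_nonneg (hg0 _)]
    exact mul_le_mul hp.1.2.le (hM _) (hg0 _) hr.le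
  rw [show (∫ p in Ioo 0 (3 * π / 4) ×ˢ Ioo (-π) π, p.1 * g (p.1 • dir p.2)) =
      ∫ p in Ioo 0 (3 * π / 4) ×ˢ Ioo (-π) π, F p from rfl, setIntegral_prod_symm_real F hFint]
  -- the constant of the radial window and the angular majorant
  set K : ℝ := π / 4 * M * (2 * wr) with hK
  have hK0 : 0 ≤ K := by positivity
  set W : ℝ → ℝ := fun θ => ∑ j ∈ ({-1, 0, 1} : Finset ℤ),
    (Icc (θ₀ + 2 * π * j - wa) (θ₀ + 2 * π * j + wa)).indicator (fun _ => K) θ with hW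
  -- the radial window bound at every angle
  have hradial : ∀ θ ∈ Ioo (-π) π, ∫ ρ in Ioo 0 (3 * π / 4), F (ρ, θ) ≤ K := by
    intro θ hθ
    have hpt : ∀ ρ ∈ Ioo 0 (3 * π / 4),
        F (ρ, θ) ≤ (Icc (u θ - wr) (u θ + wr)).indicator (fun _ => π / 4 * M) ρ := by
      intro ρ hρ
      by_cases hg : g (ρ • dir θ) = 0
      · simp only [hF, hg, mul_zero]
        exact Set.indicator_nonneg (fun _ _ => by positivity) _
      · obtain ⟨hρ4, hρu, -⟩ := hsupp ρ θ hρ hθ hg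
        have hmem : ρ ∈ Icc (u θ - wr) (u θ + wr) :=
          ⟨by linarith [(abs_le.1 hρu).1], by linarith [(abs_le.1 hρu).2]⟩
        rw [Set.indicator_of_mem hmem]
        exact mul_le_mul hρ4 (hM _) (hg0 _) (by positivity)
    have hIint : Integrable ((Icc (u θ - wr) (u θ + wr)).indicator fun _ : ℝ => π / 4 * M) :=
      (continuous_const.integrableOn_Icc).integrable_indicator measurableSet_Icc
    have hFθm : Measurable fun ρ => F (ρ, θ) := hFm.comp (measurable_id.prodMk measurable_const)
    have hFθint : IntegrableOn (fun ρ => F (ρ, θ)) (Ioo 0 (3 * π / 4)) := by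
      refine IntegrableOn.of_bound (by simp [Real.volume_Ioo]) hFθm.aestronglyMeasurable (3 * π / 4 * M) ?_
      refine (ae_restrict_iff' measurableSet_Ioo).2 (Eventually.of_forall fun ρ hρ => ?_)
      have hρ1 : 0 < ρ := hρ.1
      rw [Real.norm_eq_abs, hF, abs_mul, abs_of_pos hρ1, abs_of_nonneg (hg0 _)]
      exact mul_le_mul hρ.2.le (hM _) (hg0 _) hr.le
    calc ∫ ρ in Ioo 0 (3 * π / 4), F (ρ, θ)
        ≤ ∫ ρ in Ioo 0 (3 * π / 4), (Icc (u θ - wr) (u θ + wr)).indicator (fun _ => π / 4 * M) ρ :=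
          setIntegral_mono_on hFθint hIint.integrableOn measurableSet_Ioo hpt
      _ ≤ ∫ ρ, (Icc (u θ - wr) (u θ + wr)).indicator (fun _ => π / 4 * M) ρ :=
          setIntegral_le_integral hIint (Eventually.of_forall fun ρ =>
            Set.indicator_nonneg (fun _ _ => by positivity) _)
      _ = K := by
          rw [integral_indicator_const _ measurableSet_Icc, Real.volume_real_Icc_of_le (by linarith),
            smul_eq_mul, hK]
          ring
  -- the angular majorant
  have hinner : ∀ θ ∈ Ioo (-π) π, ∫ ρ in Ioo 0 (3 * π / 4), F (ρ, θ) ≤ W θ := by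
    intro θ hθ
    have hWnonneg : 0 ≤ W θ :=
      Finset.sum_nonneg fun j _ => Set.indicator_nonneg (fun _ _ => hK0) _
    by_cases hex : ∃ ρ ∈ Ioo (0 : ℝ) (3 * π / 4), g (ρ • dir θ) ≠ 0
    · obtain ⟨ρ, hρ, hg⟩ := hex
      obtain ⟨-, -, j, hj⟩ := hsupp ρ θ hρ hθ hg
      have h1 := (abs_le.1 hj).1
      have h2 := (abs_le.1 hj).2
      have hjlo : (-2 : ℝ) < j := by
        by_contra hc; push Not at hc
        have : 2 * π * (j : ℝ) ≤ 2 * π * (-2) := mul_le_mul_of_nonneg_left hc (by positivity)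
        linarith [hθ.1, hθ₀.2]
      have hjhi : (j : ℝ) < 1 := by
        by_contra hc; push Not at hc
        have : 2 * π * (1 : ℝ) ≤ 2 * π * j := mul_le_mul_of_nonneg_left hc (by positivity)
        linarith [hθ.2, hθ₀.1]
      have hjlo' : -2 < j := by exact_mod_cast hjlo
      have hjhi' : j < 1 := by exact_mod_cast hjhi
      have hjmem : j ∈ ({-1, 0, 1} : Finset ℤ) := by
        simp only [Finset.mem_insert, Finset.mem_singleton]; omega
      have hθmem : θ ∈ Icc (θ₀ + 2 * π * j - wa) (θ₀ + 2 * π * j + wa) := ⟨by linarith, by linarith⟩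
      calc ∫ ρ in Ioo 0 (3 * π / 4), F (ρ, θ) ≤ K := hradial θ hθ
        _ = (Icc (θ₀ + 2 * π * j - wa) (θ₀ + 2 * π * j + wa)).indicator (fun _ => K) θ := by
            rw [Set.indicator_of_mem hθmem]
        _ ≤ W θ := by
            change _ ≤ ∑ j' ∈ ({-1, 0, 1} : Finset ℤ),
              (Icc (θ₀ + 2 * π * j' - wa) (θ₀ + 2 * π * j' + wa)).indicator (fun _ => K) θ
            exact Finset.single_le_sum (f := fun j' : ℤ => (Icc (θ₀ + 2 * π * j' - wa)
              (θ₀ + 2 * π * j' + wa)).indicator (fun _ => K) θ)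
              (fun j' _ => Set.indicator_nonneg (fun _ _ => hK0) _) hjmem
    · push Not at hex
      have h0 : ∫ ρ in Ioo 0 (3 * π / 4), F (ρ, θ) = 0 :=
        setIntegral_eq_zero_of_forall_eq_zero fun ρ hρ => by simp only [hF, hex ρ hρ, mul_zero]
      rw [h0]; exact hWnonneg
  -- integrate the majorant
  have hIccint : ∀ j : ℤ, Integrable ((Icc (θ₀ + 2 * π * j - wa) (θ₀ + 2 * π * j + wa)).indicator
      fun _ : ℝ => K) := fun j =>
    (continuous_const.integrableOn_Icc).integrable_indicator measurableSet_Icc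
  have hWint : Integrable W := integrable_finsetSum _ fun j _ => hIccint j
  have hWnn : ∀ θ, 0 ≤ W θ := fun θ => Finset.sum_nonneg fun j _ => Set.indicator_nonneg (fun _ _ => hK0) _
  calc ∫ θ in Ioo (-π) π, ∫ ρ in Ioo 0 (3 * π / 4), F (ρ, θ)
      ≤ ∫ θ in Ioo (-π) π, W θ :=
        setIntegral_mono_on (integrableOn_inner_real hFint) hWint.integrableOn measurableSet_Ioo hinner
    _ ≤ ∫ θ, W θ := setIntegral_le_integral hWint (Eventually.of_forall hWnn)
    _ = ∑ j ∈ ({-1, 0, 1} : Finset ℤ), ∫ θ, (Icc (θ₀ + 2 * π * j - wa) (θ₀ + 2 * π * j + wa)).indicator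
          (fun _ => K) θ := integral_finsetSum _ fun j _ => hIccint j
    _ = ∑ j ∈ ({-1, 0, 1} : Finset ℤ), K * (2 * wa) := by
        refine Finset.sum_congr rfl fun j _ => ?_
        rw [integral_indicator_const _ measurableSet_Icc, Real.volume_real_Icc_of_le (by linarith), smul_eq_mul]
        ring
    _ = 6 * wa * K := by
        rw [Finset.sum_const]
        simp
        ring

/-- **The frequency count, uniform in `β`**: if every `j ∈ S` has `|k₀(j)| ≤ R` then `(1/β)·#S ≤ 4R/π`
(if `S ≠ ∅` then `π/β ≤ R`). [cite: BenfattoGiulianiMastropietro2006, §2.3 (2.31a) p0007:L137] -/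
private theorem inv_beta_mul_card_le' {β R : ℝ} (hβ : 0 < β) (hR : 0 ≤ R) (S : Finset ℤ)
    (hS : ∀ j ∈ S, |fermiMatsubara β j| ≤ R) : 1 / β * (S.card : ℝ) ≤ 4 * R / π := by
  rcases S.eq_empty_or_nonempty with hSe | ⟨j, hj⟩
  · rw [hSe, Finset.card_empty, Nat.cast_zero, mul_zero]; positivity
  · have h1 : π / β ≤ R := (pi_div_le_abs_fermiMatsubara hβ j).trans (hS j hj)
    have hcard := card_fermiMatsubara_le hβ hR S hS
    have h3 : (3 : ℝ) ≤ 3 * (R * β / π) := by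
      rw [div_le_iff₀ hβ] at h1
      have : 1 ≤ R * β / π := by rw [le_div_iff₀ Real.pi_pos]; linarith
      linarith
    have h4 : (S.card : ℝ) ≤ 4 * (R * β / π) := by linarith
    calc 1 / β * (S.card : ℝ) ≤ 1 / β * (4 * (R * β / π)) :=
          mul_le_mul_of_nonneg_left h4 (by positivity)
      _ = 4 * R / π := by field_simp

/-- A finite Matsubara box containing every frequency with `|k₀| ≤ R`, all of whose members satisfy
`|k₀| ≤ R`. [folklore] -/
private theorem exists_matsubara_box' (hβ : 0 < β) (R : ℝ) :
    ∃ S : Finset ℤ, (∀ j ∈ S, |fermiMatsubara β j| ≤ R) ∧ (∀ j, |fermiMatsubara β j| ≤ R → j ∈ S) := by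
  refine ⟨(Finset.Icc (-(⌈R * β / (2 * π)⌉₊ : ℤ)) (⌈R * β / (2 * π)⌉₊ : ℤ)).filter
      fun j => |fermiMatsubara β j| ≤ R,
    fun j hj => (Finset.mem_filter.1 hj).2, fun j hj => ?_⟩
  exact Finset.mem_filter.2 ⟨natAbs_le_of_abs_fermiMatsubara_le hβ hj, hj⟩

/-- The slice integrand `q⃗ ↦ F_{h,ω}(k₀, q⃗)/D_{h-1}(k₀, q⃗)` is measurable. [folklore] -/
private theorem measurable_sectorIntegrand (hS : BGMSmoothness β U C hβ E) (e₀ μ : ℝ) (h' : ℤ) (m : ℕ)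
    (ω : ℤ) (k₀ : ℝ) :
    Measurable fun q : Fin 2 → ℝ => ((bgmSectorFn e₀ μ E h' m ω (k₀, q) : ℝ) : ℂ) /
      bgmDenom μ E (h' - 1) (k₀, q) := by
  have hc : ∀ h'' : ℤ, Continuous fun q : Fin 2 → ℝ => E h'' (k₀, q) := fun h'' => (hS.1 h'' k₀ 0).continuous
  have hD : ∀ h'' : ℤ, Continuous fun q : Fin 2 → ℝ => bgmDenom μ E h'' (k₀, q) := fun h'' => by
    simp only [bgmDenom]
    exact continuous_const.add ((hc h'').sub continuous_const)
  have hsh : Continuous fun q : Fin 2 → ℝ => bgmShell e₀ μ E h' (k₀, q) := by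
    simp only [bgmShell, bgmCutoffInv]
    exact ((contDiff_gnScaleCutoff 4 e₀ h' (m := 0)).continuous.comp (hD h').norm).sub
      ((contDiff_gnScaleCutoff 4 e₀ (h' - 1) (m := 0)).continuous.comp (hD (h' - 1)).norm)
  have hζ : Measurable fun q : Fin 2 → ℝ => sectorWeightCirc m ω (polarAngle q) :=
    (contDiff_sectorWeightCirc m ω (m := 0)).continuous.measurable.comp
      (Complex.measurable_arg.comp (contDiff_momToComplex (m := 0)).continuous.measurable)
  simp only [bgmSectorFn]
  simp_rw [div_eq_mul_inv]
  exact (Complex.measurable_ofReal.comp (hsh.measurable.mul hζ)).mul (hD (h' - 1)).measurable.inv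

/-- **The momentum slice at one frequency is dimensionally small, every scale, every `x⃗`**: for a shift
`|pᵢ| < π/4`, `|∫_{[-π,π]²} e^{-ik⃗'·x⃗} F_{h,ω}(k₀,k⃗'+p⃗)/D_{h-1}(k₀,k⃗'+p⃗) dk⃗'| ≤ 6(3w_m/4)·(π/4)(16γ^{-h}/e₀)·2e₀γ^h/m`
(`= 18π²w_m/c`: the sup `16γ^{-h}/e₀` of the integrand times the measure `≲ w_m · e₀γ^h` of its support).
[cite: BenfattoGiulianiMastropietro2006, §2.5 (2.50) and proof of Lemma 2.2 p0011:L3–L7] -/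
theorem norm_slice_le (hI : BGMInitial E) (hS : BGMSmoothness β U C hβ E)
    (he : 0 < e₀) (hh₁ : hβ ≤ h) (hh₀ : h ≤ 0) (hU : |U| ≤ c₀) (hUh : |U| * |(hβ : ℝ)| ≤ c₀)
    (hμ₁ : -4 < μ) (hK₀ : |C 0| * c₀ ≤ 3 / 16 * e₀) (hgap : μ + e₀ + 2 * |C 0| * c₀ < -2 - Real.sqrt 2)
    (hgap' : 2 * |C 0| * c₀ ≤ (μ + 4 - e₀) / 2) (he4 : e₀ < μ + 4)
    (hδ₁ : 2 * (2 * |C 1| * c₀ ^ 2) ≤ 2 / π * Real.sqrt ((μ + 4 - e₀) / 2))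
    {p : Fin 2 → ℝ} (hp : ∀ i, |p i| < π / 4) (m : ℕ) {ω : ℕ} (hω : ω < sectorCount m) (j : ℤ)
    (x : Fin 2 → ℤ) :
    ‖∫ k in zoneSq, Complex.exp (-(Complex.I * ((dot2 k (fun i => (x i : ℝ)) : ℝ) : ℂ))) *
        (((bgmSectorFn e₀ μ E h m ω (fermiMatsubara β j, k + p) : ℝ) : ℂ) /
          bgmDenom μ E (h - 1) (fermiMatsubara β j, k + p))‖ ≤
      6 * (3 * sectorWidth m / 4) * (π / 4 * (16 * (4 : ℝ) ^ (-h) / e₀) *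
        (2 * (e₀ * (4 : ℝ) ^ h / (2 / π * Real.sqrt ((μ + 4 - e₀) / 2))))) := by
  have hπ := Real.pi_pos
  have hrB : (0 : ℝ) < 3 * π / 4 := by positivity
  have h4 : (0 : ℝ) < (4 : ℝ) ^ h := zpow_pos (by norm_num) _
  have hc0 : 0 < Real.sqrt ((μ + 4 - e₀) / 2) := Real.sqrt_pos.2 (by linarith)
  have hw := sectorWidth_pos m
  set B : Set (Fin 2 → ℝ) := {q | q 0 ^ 2 + q 1 ^ 2 < (3 * π / 4) ^ 2} with hB
  -- the integrand as a function of `q = k + p`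
  set G : (Fin 2 → ℝ) → ℂ := fun q => Complex.exp (-(Complex.I * ((dot2 (q - p) (fun i => (x i : ℝ)) : ℝ) : ℂ))) *
    (((bgmSectorFn e₀ μ E h m ω (fermiMatsubara β j, q) : ℝ) : ℂ) /
      bgmDenom μ E (h - 1) (fermiMatsubara β j, q)) with hG
  have hGeq : (fun k => Complex.exp (-(Complex.I * ((dot2 k (fun i => (x i : ℝ)) : ℝ) : ℂ))) *
      (((bgmSectorFn e₀ μ E h m ω (fermiMatsubara β j, k + p) : ℝ) : ℂ) /
        bgmDenom μ E (h - 1) (fermiMatsubara β j, k + p))) = fun k => G (k + p) := by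
    funext k; simp only [hG, add_sub_cancel_right]
  have hshell : ∀ q, G q ≠ 0 → bgmShell e₀ μ E h (fermiMatsubara β j, q) ≠ 0 := by
    intro q hq hf
    apply hq
    simp only [hG, bgmSectorFn, hf, zero_mul, Complex.ofReal_zero, zero_div, mul_zero]
  -- translation to the disc
  have hstep1 : (∫ k in zoneSq, G (k + p)) = ∫ q, B.indicator G q := by
    refine setIntegral_zoneSq_comp_add_eq G p B (fun q hq hGq => ?_) (fun q hq => ?_)
    · have hb := sq_add_sq_lt_of_bgmShell_ne_zero_of_sub_mem hI hS he hh₁ hh₀ hU hUh hμ₁ hK₀ hgap hp hq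
        (hshell q hGq)
      simp only [hB, Set.mem_setOf_eq]
      refine lt_trans hb ?_
      nlinarith [Real.pi_pos]
    · simp only [hB, Set.mem_setOf_eq] at hq
      intro i _
      have hqi := abs_apply_lt_of_sq_add_sq_lt hrB.le hq i
      have hpi := hp i
      simp only [Pi.sub_apply, Set.mem_Icc]
      constructor <;> linarith [(abs_lt.1 hqi).1, (abs_lt.1 hqi).2, (abs_lt.1 hpi).1, (abs_lt.1 hpi).2]
  rw [hGeq, hstep1]
  -- the norm inside, then the support lemma with `g = ‖G‖`
  have hnorm : ‖∫ q, B.indicator G q‖ ≤ ∫ q, B.indicator (fun q => ‖G q‖) q := by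
    refine (norm_integral_le_integral_norm _).trans (le_of_eq ?_)
    congr 1; funext q; rw [norm_indicator_eq_indicator_norm]
  refine hnorm.trans ?_
  have hGm : Measurable G := by
    have hph : Continuous fun q : Fin 2 → ℝ =>
        Complex.exp (-(Complex.I * ((dot2 (q - p) (fun i => (x i : ℝ)) : ℝ) : ℂ))) := by
      refine Complex.continuous_exp.comp (Continuous.neg (continuous_const.mul
        (Complex.continuous_ofReal.comp ?_)))
      simp only [dot2]
      fun_prop
    exact hph.measurable.mul (measurable_sectorIntegrand hS e₀ μ h m ω (fermiMatsubara β j))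
  have hM : ∀ q, ‖G q‖ ≤ 16 * (4 : ℝ) ^ (-h) / e₀ := fun q => by
    rw [hG, norm_mul, Literature.Analysis.Fourier.norm_cexp_neg_I_mul_ofReal, one_mul]
    exact norm_sectorIntegrand_le (μ := μ) hS he hh₁ hh₀ hU hUh hK₀ m ω j q
  have hθ₀ : sectorCenter m ω ∈ Icc 0 (2 * π) := by
    have hN := sectorCount_mul_sectorWidth m
    have hω' : (ω : ℝ) + 1 ≤ sectorCount m := by exact_mod_cast hω
    refine ⟨by unfold sectorCenter; positivity, ?_⟩
    unfold sectorCenter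
    nlinarith
  have hwa : 3 * sectorWidth m / 4 ≤ π := by linarith [sectorWidth_le_pi m]
  refine integral_indicator_ball_le_of_support hGm.norm (fun q => norm_nonneg _) (by positivity) hM hθ₀
    (by positivity) hwa (by positivity) (levelRadius (fun q => (E h (fermiMatsubara β j, q)).re) μ)
    fun ρ θ hρ hθ hg => ?_
  have hGne : G (ρ • dir θ) ≠ 0 := fun h0 => hg (by rw [h0, norm_zero])
  have hf := hshell _ hGne
  obtain ⟨hρ4, hρu⟩ := radial_localisation hI hS he hh₁ hh₀ hU hUh hμ₁ hK₀ hgap hgap' he4 hδ₁ hρ hf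
  refine ⟨hρ4, hρu, ?_⟩
  -- the angular window from the sector weight
  have hζ : sectorWeightCirc m ω (polarAngle (ρ • dir θ)) ≠ 0 := by
    intro hz
    apply hGne
    simp only [hG, bgmSectorFn, hz, mul_zero, Complex.ofReal_zero, zero_div]
  rw [polarAngle_smul_dir' hρ.1 ⟨hθ.1, hθ.2.le⟩] at hζ
  by_contra hnone
  push Not at hnone
  refine hζ (sectorWeightCirc_eq_zero fun k => ?_)
  have := hnone k
  rw [sectorCenter] at this
  push_cast
  exact this.le

/-- **(2.49) at general `x`: the dimensional bound, every scale, uniformly in `β`** — under (2.36) with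
the smallness constraints on `c₀`: `|g(x₀, x⃗)| ≤ (1/β)#{k₀ : |k₀| ≤ 8e₀γ^h} · 18π²w_m/c /(2π)² ≤ 144 e₀γ^h w_m/(πc)`.
[cite: BenfattoGiulianiMastropietro2006, §2.5 (2.50) p0011:L3–L7] -/
theorem norm_bgmGenProp_le_of_smallness (hI : BGMInitial E) (hSy : BGMSymmetry E) (hS : BGMSmoothness β U C hβ E)
    (he : 0 < e₀) (hβpos : 0 < β) (hh₁ : hβ ≤ h) (hh₀ : h ≤ 0) (hU : |U| ≤ c₀) (hUh : |U| * |(hβ : ℝ)| ≤ c₀)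
    (hμ₁ : -4 < μ) (hK₀ : |C 0| * c₀ ≤ 3 / 16 * e₀) (hK₁ : 2 * |C 1| * c₀ ^ 2 ≤ 1 / 2)
    (hK₂' : 2 * (4 * |C 2| * c₀ ^ 2) * (2 * |C 0| * c₀ + 2 * e₀) ≤ 1)
    (hgap : μ + e₀ + 2 * |C 0| * c₀ < -2 - Real.sqrt 2)
    (hgap' : 2 * |C 0| * c₀ ≤ (μ + 4 - e₀) / 2) (he4 : e₀ < μ + 4)
    (hδ₁ : 2 * (2 * |C 1| * c₀ ^ 2) ≤ 2 / π * Real.sqrt ((μ + 4 - e₀) / 2))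
    (m : ℕ) {ω : ℕ} (hω : ω < sectorCount m) (x₀ : ℝ) (x : Fin 2 → ℤ) :
    ‖bgmGenProp β e₀ μ E h m ω x₀ x‖ ≤
      144 * e₀ * (4 : ℝ) ^ h * sectorWidth m / (π * Real.sqrt ((μ + 4 - e₀) / 2)) := by
  have hπ := Real.pi_pos
  have h4 : (0 : ℝ) < (4 : ℝ) ^ h := zpow_pos (by norm_num) _
  have hc0 : 0 < Real.sqrt ((μ + 4 - e₀) / 2) := Real.sqrt_pos.2 (by linarith)
  have hw := sectorWidth_pos m
  have hc₀ : 0 ≤ c₀ := (abs_nonneg U).trans hU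
  obtain ⟨S, hSR, hmem⟩ := exists_matsubara_box' hβpos (8 * e₀ * (4 : ℝ) ^ h)
  -- the Fermi point of the sector centre lies in the disc `|p_i| < π/4`
  have hpFi : ∀ i, |(levelRadius (bgmEffDisp β E h) μ (sectorCenter m ω) • dir (sectorCenter m ω)) i| < π / 4 := by
    obtain ⟨hε2, h0', -, -⟩ := bgmEffDisp_perturbation hI hS hh₁ hh₀
    have h0 : ∀ k, |bgmEffDisp β E h k - sqDispersion k| ≤ 2 * |C 0| * c₀ := fun k =>
      (h0' k).trans (by gcongr)
    have hc'pos : 0 < Real.sqrt ((μ + 4) / 2) := Real.sqrt_pos.2 (by linarith)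
    have hc'sq : Real.sqrt ((μ + 4) / 2) ^ 2 = (μ + 4) / 2 := Real.sq_sqrt (by linarith)
    have hcδ : 2 * (0 : ℝ) < 4 / π * Real.sqrt ((μ + 4) / 2) := by rw [mul_zero]; positivity
    have hlev : μ ∈ Ioo (Real.sqrt ((μ + 4) / 2) ^ 2 + 2 * |C 0| * c₀ - 4)
        (-2 - Real.sqrt 2 - 2 * |C 0| * c₀) := by
      rw [hc'sq]; constructor <;> linarith
    obtain ⟨hroot, -, huK, hK⟩ := levelRadius_bounds hε2 h0 le_rfl hcδ hlev (sectorCenter m ω)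
    intro i
    refine (abs_smul_dir_apply_le _ _ i).trans_lt ?_
    rw [abs_of_nonneg hroot.1.1]; exact lt_of_le_of_lt huK hK
  rw [bgmGenProp_eq_sum hI hSy hS he hβpos hh₁ hh₀ hU hUh hK₀ hK₁ hK₂' m ω x₀ x hmem, norm_mul,
    Complex.norm_real, Real.norm_eq_abs, abs_of_pos (by positivity : (0 : ℝ) < 1 / β)]
  set Θ : ℝ := 6 * (3 * sectorWidth m / 4) * (π / 4 * (16 * (4 : ℝ) ^ (-h) / e₀) *
    (2 * (e₀ * (4 : ℝ) ^ h / (2 / π * Real.sqrt ((μ + 4 - e₀) / 2))))) with hΘ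
  have hterm : ∀ j' ∈ S, ‖Complex.exp (-(Complex.I * ((π * (2 * (j' : ℝ) + 1) / β * x₀ : ℝ) : ℂ))) •
      ((∫ k in zoneSq, Complex.exp (-(Complex.I * ((dot2 k (fun i => (x i : ℝ)) : ℝ) : ℂ))) *
        (((bgmSectorFn e₀ μ E h m ω
            (fermiMatsubara β j', k + levelRadius (bgmEffDisp β E h) μ (sectorCenter m ω) • dir (sectorCenter m ω)) : ℝ) : ℂ) /
          bgmDenom μ E (h - 1)
            (fermiMatsubara β j', k + levelRadius (bgmEffDisp β E h) μ (sectorCenter m ω) • dir (sectorCenter m ω)))) /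
        (((2 * π) ^ 2 : ℝ) : ℂ))‖ ≤ Θ / (2 * π) ^ 2 := by
    intro j' _
    rw [norm_smul, Literature.Analysis.Fourier.norm_cexp_neg_I_mul_ofReal, one_mul, norm_div, Complex.norm_real, Real.norm_eq_abs,
      abs_of_pos (by positivity : (0 : ℝ) < (2 * π) ^ 2)]
    exact div_le_div_of_nonneg_right
      (norm_slice_le hI hS he hh₁ hh₀ hU hUh hμ₁ hK₀ hgap hgap' he4 hδ₁ hpFi m hω j' x) (by positivity)
  have hΘ0 : 0 ≤ Θ := by rw [hΘ]; positivity
  have hβS := inv_beta_mul_card_le' hβpos (by positivity) S hSR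
  refine (mul_le_mul_of_nonneg_left ((norm_sum_le _ _).trans (Finset.sum_le_sum hterm)) (by positivity)).trans ?_
  rw [Finset.sum_const, nsmul_eq_mul]
  calc 1 / β * (S.card * (Θ / (2 * π) ^ 2)) = (1 / β * S.card) * (Θ / (2 * π) ^ 2) := by ring
    _ ≤ (4 * (8 * e₀ * (4 : ℝ) ^ h) / π) * (Θ / (2 * π) ^ 2) := mul_le_mul_of_nonneg_right hβS (by positivity)
    _ = 144 * e₀ * (4 : ℝ) ^ h * sectorWidth m / (π * Real.sqrt ((μ + 4 - e₀) / 2)) := by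
        rw [hΘ, zpow_neg]
        field_simp
        ring

/-- Small positive constants: a continuous constraint vanishing at `0` holds near `0⁺`. [folklore] -/
private theorem eventually_le_of_continuous' {f : ℝ → ℝ} (hf : Continuous f) (h0 : f 0 = 0) {b : ℝ}
    (hb : 0 < b) : ∀ᶠ c in 𝓝[>] (0 : ℝ), f c ≤ b :=
  ((hf.tendsto' 0 0 h0).eventually_le_const hb).filter_mono nhdsWithin_le_nhds

/-- Strict version of `eventually_le_of_continuous'`. [folklore] -/
private theorem eventually_lt_of_continuous' {f : ℝ → ℝ} (hf : Continuous f) (h0 : f 0 = 0) {b : ℝ}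
    (hb : 0 < b) : ∀ᶠ c in 𝓝[>] (0 : ℝ), f c < b :=
  ((hf.tendsto' 0 0 h0).eventually_lt_const hb).filter_mono nhdsWithin_le_nhds

/-- **The dimensional bound (2.50) for the general sector propagator, at every `x` and every scale** —
the `N = 0` content of Lemmas 2.2/2.3 with the angular index `m` free: there are `c₀ > 0` and `K` (depending
on `μ, e₀` and the constants `C` of (2.36)) such that under (2.36) with `|U| ≤ c₀`, `|U||h_β| ≤ c₀`, for every
scale `h_β ≤ h ≤ 0`, every `m`, every sector `ω < sectorCount m` and every `(x₀, x⃗)`: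
`|g(x₀, x⃗)| ≤ K γ^h w_m` (`w_m = π/2^m` the sector width). [cite: BenfattoGiulianiMastropietro2006, §2.5 (2.50) p0011:L3–L7, Lemma 2.3 (2.60) with N = 0] -/
theorem norm_bgmGenProp_le {μ e₀ : ℝ} (hμ₁ : -4 < μ) (he₀ : BGMAdmissibleE0 μ e₀) (C : ℕ → ℝ) :
    ∃ c₀ K : ℝ, 0 < c₀ ∧ 0 ≤ K ∧
    ∀ (β U : ℝ) (hβ : ℤ), 0 < β → hβ ≤ 0 → |U| ≤ c₀ → |U| * |(hβ : ℝ)| ≤ c₀ →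
    ∀ E : ℤ → ℝ × (Fin 2 → ℝ) → ℂ, BGMInitial E → BGMSymmetry E → BGMSmoothness β U C hβ E →
    ∀ h : ℤ, hβ ≤ h → h ≤ 0 → ∀ (m ω : ℕ), ω < sectorCount m → ∀ (x₀ : ℝ) (x : Fin 2 → ℤ),
      ‖bgmGenProp β e₀ μ E h m ω x₀ x‖ ≤ K * (4 : ℝ) ^ h * sectorWidth m := by
  obtain ⟨he, he2, he4⟩ := he₀
  have hπ := Real.pi_pos
  have hc0 : 0 < Real.sqrt ((μ + 4 - e₀) / 2) := Real.sqrt_pos.2 (by linarith)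
  -- the coupled-smallness constant `c₀`: six polynomial constraints vanishing at `c₀ = 0`
  obtain ⟨c₀, ⟨hK₀, hK₁, hK₂', hgap, hgap', hδ₁⟩, hc₀pos⟩ :
      ∃ c₀ : ℝ, (|C 0| * c₀ ≤ 3 / 16 * e₀ ∧ 2 * |C 1| * c₀ ^ 2 ≤ 1 / 2 ∧
        2 * (4 * |C 2| * c₀ ^ 2) * (2 * |C 0| * c₀ + 2 * e₀) ≤ 1 ∧
        2 * |C 0| * c₀ < -2 - Real.sqrt 2 - μ - e₀ ∧
        2 * |C 0| * c₀ ≤ (μ + 4 - e₀) / 2 ∧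
        2 * (2 * |C 1| * c₀ ^ 2) ≤ 2 / π * Real.sqrt ((μ + 4 - e₀) / 2)) ∧ 0 < c₀ :=
    (((eventually_le_of_continuous' (f := fun c => |C 0| * c) (by fun_prop) (by simp) (by positivity)).and <|
      (eventually_le_of_continuous' (f := fun c => 2 * |C 1| * c ^ 2) (by fun_prop) (by simp) (by norm_num)).and <|
      (eventually_le_of_continuous' (f := fun c => 2 * (4 * |C 2| * c ^ 2) * (2 * |C 0| * c + 2 * e₀))
        (by fun_prop) (by simp) one_pos).and <|
      (eventually_lt_of_continuous' (f := fun c => 2 * |C 0| * c) (by fun_prop) (by simp)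
        (by linarith : (0 : ℝ) < -2 - Real.sqrt 2 - μ - e₀)).and <|
      (eventually_le_of_continuous' (f := fun c => 2 * |C 0| * c) (by fun_prop) (by simp)
        (by linarith : (0 : ℝ) < (μ + 4 - e₀) / 2)).and <|
      (eventually_le_of_continuous' (f := fun c => 2 * (2 * |C 1| * c ^ 2)) (by fun_prop) (by simp)
        (by positivity : (0 : ℝ) < 2 / π * Real.sqrt ((μ + 4 - e₀) / 2)))).and
      eventually_mem_nhdsWithin).exists
  refine ⟨c₀, 144 * e₀ / (π * Real.sqrt ((μ + 4 - e₀) / 2)), hc₀pos, by positivity, ?_⟩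
  intro β U hβ hβpos hhβ hU hUh E hI hSy hS h hh₁ hh₀ m ω hω x₀ x
  have hb := norm_bgmGenProp_le_of_smallness hI hSy hS he hβpos hh₁ hh₀ hU hUh hμ₁ hK₀ hK₁ hK₂' (by linarith)
    hgap' he4 hδ₁ m hω x₀ x
  refine hb.trans (le_of_eq ?_)
  field_simp

/-- `γ^h·(π/2^n) = π·2^{3h}` for `n = -h` (anisotropic sectors). [folklore] -/
private theorem zpow_mul_sectorWidth_aniso {h : ℤ} (hh : h ≤ 0) :
    (4 : ℝ) ^ h * sectorWidth (bgmScaleIdx h) = π * (2 : ℝ) ^ (3 * h) := by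
  have hn : ((bgmScaleIdx h : ℕ) : ℤ) = -h := by simp [bgmScaleIdx, Int.toNat_of_nonneg (neg_nonneg.2 hh)]
  rw [sectorWidth, ← zpow_natCast, hn, show (4 : ℝ) = (2 : ℝ) ^ (2 : ℤ) by norm_num, ← zpow_mul,
    show (3 : ℤ) * h = 2 * h + h by ring, zpow_add₀ (by norm_num : (2 : ℝ) ≠ 0) (2 * h) h, zpow_neg]
  field_simp

/-- `γ^h·(π/2^{2n}) = π·4^{2h}` for `n = -h` (isotropic sectors). [folklore] -/
private theorem zpow_mul_sectorWidth_iso {h : ℤ} (hh : h ≤ 0) :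
    (4 : ℝ) ^ h * sectorWidth (2 * bgmScaleIdx h) = π * (4 : ℝ) ^ (2 * h) := by
  have hn : ((bgmScaleIdx h : ℕ) : ℤ) = -h := by simp [bgmScaleIdx, Int.toNat_of_nonneg (neg_nonneg.2 hh)]
  rw [sectorWidth, pow_mul, show (2 : ℝ) ^ 2 = 4 by norm_num, ← zpow_natCast, hn]
  rw [show (2 : ℤ) * h = h + h by ring, zpow_add₀ (by norm_num : (4 : ℝ) ≠ 0) h h, zpow_neg]
  field_simp

/-- **Lemma 2.2 of BGM06 at `N = 0`, PROVED**: the dimensional bound (2.50) `|g^{(h)}_ω(x)| ≤ Cγ^{3h/2}`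
for the anisotropic sector propagators at inverse temperature `β`, every scale `h_β ≤ h ≤ 0`, every sector and
every `x`, in the quantifier structure of the named fact `BGM2006_Lemma_2_2` (with `γ^{3h/2} = 2^{3h}`).
[cite: BenfattoGiulianiMastropietro2006, §2.5 (2.50) p0011:L3–L7] -/
theorem norm_bgmSectorProp_le {μ e₀ : ℝ} (hμ₁ : -4 < μ) (he₀ : BGMAdmissibleE0 μ e₀) (C : ℕ → ℝ) :
    ∃ c₀ C' : ℝ, 0 < c₀ ∧
    ∀ (β U₀ U : ℝ) (hβ : ℤ), 0 < β → hβ ≤ 0 → |U| ≤ U₀ → |(hβ : ℝ)| * U₀ ≤ c₀ →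
    ∀ E : ℤ → ℝ × (Fin 2 → ℝ) → ℂ, BGMInitial E → BGMSymmetry E → BGMSmoothness β U C hβ E →
    ∀ h : ℤ, hβ ≤ h → h ≤ 0 → ∀ ω : ℕ, ω < sectorCount (bgmScaleIdx h) →
    ∀ (x₀ : ℝ) (x : Fin 2 → ℤ), ‖bgmSectorProp β e₀ μ E h ω x₀ x‖ ≤ C' * (2 : ℝ) ^ (3 * h) := by
  obtain ⟨c₀, K, hc₀, hK, hmain⟩ := norm_bgmGenProp_le hμ₁ he₀ C
  refine ⟨c₀, K * π, hc₀, ?_⟩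
  intro β U₀ U hβ hβpos hhβ hU hc E hI hSy hS h hh₁ hh₀ ω hω x₀ x
  obtain ⟨U', hS', hU1, hU2⟩ := bgmSmoothness_wlog hS hhβ hU hc hc₀.le
  have h1 := hmain β U' hβ hβpos hhβ hU1 hU2 E hI hSy hS' h hh₁ hh₀ (bgmScaleIdx h) ω hω x₀ x
  rw [mul_assoc, zpow_mul_sectorWidth_aniso hh₀] at h1
  calc _ ≤ K * (π * (2 : ℝ) ^ (3 * h)) := h1
    _ = K * π * (2 : ℝ) ^ (3 * h) := by ring

/-- **Lemma 2.3 of BGM06 at `N = 0`, PROVED**: `|ḡ^{(h)}_ω̄(x)| ≤ Cγ^{2h}` for the isotropic sector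
propagators at inverse temperature `β`, every scale `h_β ≤ h ≤ 0`, every isotropic sector and every `x`,
in the quantifier structure of the named fact `BGM2006_Lemma_2_3`. [cite: BenfattoGiulianiMastropietro2006, §2.5 Lemma 2.3 (2.60) with N = 0, p0011:L154] -/
theorem norm_bgmIsoProp_le {μ e₀ : ℝ} (hμ₁ : -4 < μ) (he₀ : BGMAdmissibleE0 μ e₀) (C : ℕ → ℝ) :
    ∃ c₀ C' : ℝ, 0 < c₀ ∧
    ∀ (β U₀ U : ℝ) (hβ : ℤ), 0 < β → hβ ≤ 0 → |U| ≤ U₀ → |(hβ : ℝ)| * U₀ ≤ c₀ →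
    ∀ E : ℤ → ℝ × (Fin 2 → ℝ) → ℂ, BGMInitial E → BGMSymmetry E → BGMSmoothness β U C hβ E →
    ∀ h : ℤ, hβ ≤ h → h ≤ 0 → ∀ ω : ℕ, ω < sectorCount (2 * bgmScaleIdx h) →
    ∀ (x₀ : ℝ) (x : Fin 2 → ℤ), ‖bgmIsoProp β e₀ μ E h ω x₀ x‖ ≤ C' * (4 : ℝ) ^ (2 * h) := by
  obtain ⟨c₀, K, hc₀, hK, hmain⟩ := norm_bgmGenProp_le hμ₁ he₀ C
  refine ⟨c₀, K * π, hc₀, ?_⟩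
  intro β U₀ U hβ hβpos hhβ hU hc E hI hSy hS h hh₁ hh₀ ω hω x₀ x
  obtain ⟨U', hS', hU1, hU2⟩ := bgmSmoothness_wlog hS hhβ hU hc hc₀.le
  have h1 := hmain β U' hβ hβpos hhβ hU1 hU2 E hI hSy hS' h hh₁ hh₀ (2 * bgmScaleIdx h) ω hω x₀ x
  rw [mul_assoc, zpow_mul_sectorWidth_iso hh₀] at h1
  calc _ ≤ K * (π * (4 : ℝ) ^ (2 * h)) := h1
    _ = K * π * (4 : ℝ) ^ (2 * h) := by ring

end Support

end Literature.MathematicalPhysics.QuantumLattice.FermiRG
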